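import Literature.NumberTheory.EllipticCurves.VeluOddKernelProofs
import HarnessLib

/-!
# Vélu's isogeny, II: norms `N(x - a)`, the `2`-torsion trick, and `ψ^*ω' = ω`
# (the divisor-free form of Blakestad–Grant 2023, Prop. 7, first half; proofs only)

Trunk T-NT-EC (Literature/NumberTheory/EllipticCurves). Sequel of `VeluOddKernelProofs.lean`
(Vélu's theorem for a finite subgroup `G` without `2`-torsion of a short Weierstrass curve
`y² = f(x) = x³ + a₄x + a₆` over a field of characteristic `0`: `x₁ = U/P₂`, `y₁ = yS/P₂²`,
`f S² = P₂(U³ + a'UP₂² + b'P₂³)`, `P₂ = Π_{v ≠ O}(X - x(v))`). This file supplies the algebra by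
which Blakestad–Grant (*On the universal `p`-adic sigma and Weierstrass zeta functions*, J. Number
Theory 249 (2023), Prop. 7) control the quotient `E → E/G` by the canonical subgroup, with their
two uses of the theory of divisors ("comparing divisors, there are constants `cᵢ` … such that
`x_p - rᵢ' = cᵢ² N(x - rᵢ)`") replaced by the formal-point argument of `VeluOddKernelProofs.lean`:

* `veluXVals`, `veluD` — the `x`-values of `G ∖ O` and the KERNEL POLYNOMIAL
  `D = Π_{x-values}(X - c)` (so `P₂ = D²`, `veluP₂_eq_veluD_sq`; `#(G ∖ O) = 2·#xVals`);
* `sq_mul_xOf_add_mul_xOf_sub` — `(x₁ - x₂)²·x(P+v)x(P-v) = (x₁x₂ - a₄)² - 4a₆(x₁ + x₂)`;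
  with the companion sum formula of the prequel this is Blakestad–Grant's (5):
  `(x₁ - x₂)²·(x(P+v) - a)(x(P-v) - a) = q_{a,x₂}(x₁)` for the explicit quadratic `veluQa a c`
  (`sq_mul_prod_xOf_sub`);
* `veluV G a = (X - a)·Π_c q_{a,c}` and **`veluD_sq_mul_norm`**: for `P = (x, y) ∉ ±G`,
  `D(x)²·Π_{v ∈ G}(x(P+v) - a) = V_a(x)` — the NORM `N(x - a) = Π_{u ∈ G} τ_u^*(x - a)` is the
  rational function `V_a/D²` of `x`;
* **`veluV_eq`** (Blakestad–Grant's divisor comparison, for every `a`): `V_a = D(a)²·U + μ_a·D²`,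
  i.e. `N(x - a) = D(a)²·x₁ + μ_a` is AFFINE in Vélu's `x₁` — by the `G`-invariance of both sides
  and the general vanishing lemma `eq_zero_of_laurent_invariant` (a `G`-invariant function
  `Q(x)/D(x)^e` with `deg Q < e·#xVals` vanishes: expand at the formal point `T` and at `T + u`);
* the `2`-TORSION TRICK: for a root `r` of `f`, `μ_r = -U(r)` (`veluMu_eq_of_root`), the value
  `ρ_r = U(r)/D(r)² = x₁(ψ(r, 0))` is a root of the Vélu cubic `X³ + a'X + b'`
  (`veluRho_isRoot`), distinct roots of `f` give distinct `ρ` (`veluRho_injective`, by counting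
  the `p + 1` roots `x(Pᵢ + v)` of `U - ρD²`), hence for `f = (X - r₁)(X - r₂)(X - r₃)`:
  `ρ₁ + ρ₂ + ρ₃ = 0` and **`3U = Σᵢ V_{rᵢ}/D(rᵢ)²`** (`three_mul_veluU_eq`) — Blakestad–Grant's
  `x_p = ⅓ Σᵢ cᵢ² N(x - rᵢ)`;
* `ψ^*ω₁ = ω`: **`veluS_eq_derivative`** `S = U'P₂ - UP₂'` (so `y₁ = y·(U/P₂)'`, the normalisation
  of Vélu's isogeny), `veluMD = U'D - 2UD'` (monic of degree `3·#xVals`) with `S = D·M_D`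
  (`veluS_eq_veluD_mul`), and the quotient equation in kernel-polynomial form
  **`f·M_D² = U³ + a'UD⁴ + b'D⁶ = Πᵢ V_{rᵢ}/D(rᵢ)²`** (`veluF_mul_veluMD_sq`,
  `veluF_mul_veluMD_sq_eq_prod`) — Blakestad–Grant's `y_p = yM(x)/φ_ψ(x)³`,
  `y_p² = Πᵢ Sᵢ(x)/(φ_ψ(rᵢ)²φ_ψ(x)²)`.

The sequel (`VeluKernelReductionProofs.lean`, Blakestad–Grant Prop. 7 proper) adds the
arithmetic: when `p·D ≡ ℓ₀ (mod p)` for a unit `ℓ₀` (the canonical subgroup), resultants give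
`p²V_{rᵢ} ≡ ℓ₀²(X - rᵢ)^p`, whence `U ≡ X^p`, `M_D ≡ f^{(p-1)/2}`, `A' ≡ A^p`, `t' ≡ t^p (mod p)`.

## Sources

* C. Blakestad, D. Grant, J. Number Theory 249 (2023) (arXiv:1903.02480), §2.3: Prop. 7 and its
  proof (the norms `N(x - rᵢ)`, eq. (5), `x_p = ⅓Σcᵢ²N(x - rᵢ)`, `y_p = yM(x)/φ_ψ(x)³`),
  Lemma 11 (Vélu). [BlakestadGrant2023]
* J. Vélu, C. R. Acad. Sci. Paris 273 (1971) 238–241 (the formulae; `ψ^*` of the invariant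
  differential). [Velu1971]
* D. Kohel, thesis (Berkeley 1996), §2.4 (kernel-polynomial form). [Kohel1996]
* J. H. Silverman, *AEC* 2nd ed. (2009), III.2.3 (group law), III.4.12 (quotients). [SilvermanAEC2009]

Pure proof file: the only new data are the explicit polynomials `veluD`, `veluQa`, `veluV`,
`veluMD` and the scalars `veluMu`, `veluRho` (all with bodies); no named facts.
-/

noncomputable section

open scoped Classical

namespace WeierstrassCurve.Affine.Point

open Polynomial

/-! ### The product `x(P + v)·x(P - v)` -/

section Coordinates

variable {K : Type*} [Field K] {W : WeierstrassCurve K} [W.IsShortNF]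

/-- **`x(P + v)·x(P - v)`** for `x(P) ≠ x(v)` on `y² = x³ + a₄x + a₆`:
`(x₁ - x₂)²·x(P+v)·x(P-v) = (x₁x₂ - a₄)² - 4a₆(x₁ + x₂)`. [Silverman AEC III.2.3 (group law
algorithm); Blakestad–Grant 2023, eq. (5)] [folklore] -/
theorem sq_mul_xOf_add_mul_xOf_sub {x₁ y₁ x₂ y₂ : K} (h₁ : W.toAffine.Nonsingular x₁ y₁)
    (h₂ : W.toAffine.Nonsingular x₂ y₂) (hx : x₁ ≠ x₂) :
    (x₁ - x₂) ^ 2 * (xOf (some x₁ y₁ h₁ + some x₂ y₂ h₂) * xOf (some x₁ y₁ h₁ - some x₂ y₂ h₂)) =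
      (x₁ * x₂ - W.a₄) ^ 2 - 4 * W.a₆ * (x₁ + x₂) := by
  have hx' : x₁ - x₂ ≠ 0 := sub_ne_zero.mpr hx
  rw [sub_eq_add_neg (some x₁ y₁ h₁), neg_some, add_of_X_ne hx, add_of_X_ne hx, xOf_some, xOf_some,
    Affine.addX, Affine.addX, negY_of_isShortNF, W.a₁_of_isShortNF, W.a₂_of_isShortNF]
  set ℓ₁ := W.toAffine.slope x₁ x₂ y₁ y₂ with hℓ₁
  set ℓ₂ := W.toAffine.slope x₁ x₂ y₁ (-y₂) with hℓ₂
  have hs₁ : ℓ₁ * (x₁ - x₂) = y₁ - y₂ := by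
    rw [hℓ₁, Affine.slope_of_X_ne hx, div_mul_cancel₀ _ hx']
  have hs₂ : ℓ₂ * (x₁ - x₂) = y₁ + y₂ := by
    rw [hℓ₂, Affine.slope_of_X_ne hx, div_mul_cancel₀ _ hx', sub_neg_eq_add]
  have e₁ := yOf_sq_eq h₁
  have e₂ := yOf_sq_eq h₂
  apply mul_left_cancel₀ (pow_ne_zero 2 hx')
  have hq₁ : (ℓ₁ * (x₁ - x₂)) ^ 2 = (y₁ - y₂) ^ 2 := by rw [hs₁]
  have hq₂ : (ℓ₂ * (x₁ - x₂)) ^ 2 = (y₁ + y₂) ^ 2 := by rw [hs₂]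
  simp only [zero_mul, add_zero, sub_zero]
  set T := (x₁ + x₂) * (x₁ - x₂) ^ 2 with hT
  have key : (x₁ - x₂) ^ 2 * ((x₁ - x₂) ^ 2 * ((ℓ₁ ^ 2 - x₁ - x₂) * (ℓ₂ ^ 2 - x₁ - x₂))) =
      ((ℓ₁ * (x₁ - x₂)) ^ 2 - T) * ((ℓ₂ * (x₁ - x₂)) ^ 2 - T) := by
    rw [hT]; ring
  rw [key, hq₁, hq₂]
  linear_combination (y₁ ^ 2 - y₂ ^ 2 + (x₁ ^ 3 + W.a₄ * x₁ + W.a₆) - (x₂ ^ 3 + W.a₄ * x₂ + W.a₆) -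
      2 * T) * e₁ +
    (-(y₁ ^ 2 - y₂ ^ 2 + (x₁ ^ 3 + W.a₄ * x₁ + W.a₆) - (x₂ ^ 3 + W.a₄ * x₂ + W.a₆)) - 2 * T) * e₂

end Coordinates

/-! ### The `x`-values of the kernel and the kernel polynomial `D` (`P₂ = D²`) -/

section KernelPoly

variable {K : Type*} [Field K] {W : WeierstrassCurve K}

variable (G : Finset W.toAffine.Point)

/-- The set of `x`-coordinates of `G ∖ O`. [Kohel 1996, §2.4] [folklore] -/
def veluXVals : Finset K := (G.erase 0).image xOf

/-- **The kernel polynomial** `D = Π_{c ∈ x(G ∖ O)} (X - c)` (each `x`-value once; `P₂ = D²`).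
[Kohel 1996, §2.4 (`ψ(x)`); Blakestad–Grant 2023, (4) (`φ_ψ = p·D`)] [folklore] -/
def veluD : K[X] := ∏ c ∈ veluXVals G, (Polynomial.X - C c)

/-- `D` is monic. [folklore] -/
theorem monic_veluD : (veluD G).Monic :=
  monic_prod_of_monic _ _ fun c _ => monic_X_sub_C c

/-- `deg D = #x(G ∖ O)`. [folklore] -/
theorem natDegree_veluD : (veluD G).natDegree = (veluXVals G).card := by
  rw [veluD, natDegree_prod_of_monic _ _ fun c _ => monic_X_sub_C c]
  simp

/-- `D ≠ 0`. [folklore] -/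
theorem veluD_ne_zero : veluD G ≠ 0 := (monic_veluD G).ne_zero

/-- `D(x₀) = Π_c (x₀ - c)`. [folklore] -/
theorem eval_veluD (x₀ : K) : (veluD G).eval x₀ = ∏ c ∈ veluXVals G, (x₀ - c) := by
  rw [veluD, eval_prod]
  simp

variable {G}

/-- `D(x₀) ≠ 0` off the `x`-values of `G ∖ O`. [folklore] -/
theorem eval_veluD_ne_zero {x₀ : K} (hgood : ∀ v ∈ G.erase 0, xOf v ≠ x₀) : (veluD G).eval x₀ ≠ 0 := by
  rw [eval_veluD]
  refine Finset.prod_ne_zero_iff.mpr fun c hc => ?_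
  obtain ⟨v, hv, rfl⟩ := Finset.mem_image.mp hc
  exact sub_ne_zero.mpr (hgood v hv).symm

/-- The `x`-values of `G ∖ O` are `x`-coordinates of points of `G ∖ O`. [folklore] -/
theorem mem_veluXVals_iff {c : K} : c ∈ veluXVals G ↔ ∃ v ∈ G.erase 0, xOf v = c :=
  Finset.mem_image

/-- **The fibres of `x` on `G ∖ O` are the pairs `{u, -u}`.** [folklore] -/
theorem filter_xOf_eq (hG : IsOddSubgroupFinset G) {u : W.toAffine.Point} (hu : u ∈ G.erase 0) :
    (G.erase 0).filter (fun v => xOf v = xOf u) = {u, -u} := by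
  ext v
  rw [Finset.mem_filter, Finset.mem_insert, Finset.mem_singleton]
  constructor
  · rintro ⟨hv, hx⟩
    exact eq_or_eq_neg_of_xOf_eq (Finset.mem_erase.mp hv).1 (Finset.mem_erase.mp hu).1 hx
  · rintro (rfl | rfl)
    · exact ⟨hu, rfl⟩
    · exact ⟨hG.neg_mem_erase hu, xOf_neg u⟩

/-- **Pairing a product over `G ∖ O` along the fibres of `x`**: if `g(v)·g(-v) = h(x(v))` for
all `v ≠ O`, then `Π_{v ≠ O} g(v) = Π_{c ∈ x(G ∖ O)} h(c)`. [folklore] -/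
theorem prod_erase_zero_eq_prod_veluXVals (hG : IsOddSubgroupFinset G) {M : Type*} [CommMonoid M]
    (g : W.toAffine.Point → M) (h : K → M) (hgh : ∀ v ∈ G.erase 0, g v * g (-v) = h (xOf v)) :
    ∏ v ∈ G.erase 0, g v = ∏ c ∈ veluXVals G, h c := by
  rw [← Finset.prod_fiberwise_of_maps_to (s := G.erase 0) (t := veluXVals G) (g := xOf)
    (fun v hv => Finset.mem_image_of_mem _ hv) g]
  refine Finset.prod_congr rfl fun c hc => ?_
  obtain ⟨u, hu, rfl⟩ := Finset.mem_image.mp hc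
  rw [filter_xOf_eq hG hu, Finset.prod_pair (hG.neg_ne_self hu).symm]
  exact hgh u hu

/-- **`#(G ∖ O) = 2·#x(G ∖ O)`** (the points `±v` share their `x`-coordinate). [folklore] -/
theorem card_erase_zero_eq (hG : IsOddSubgroupFinset G) : (G.erase 0).card = 2 * (veluXVals G).card := by
  unfold veluXVals
  rw [Finset.card_eq_sum_card_image xOf (G.erase 0), Finset.card_eq_sum_ones ((G.erase 0).image xOf),
    Finset.mul_sum]
  refine Finset.sum_congr rfl fun c hc => ?_
  obtain ⟨u, hu, rfl⟩ := Finset.mem_image.mp hc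
  rw [filter_xOf_eq hG hu, Finset.card_pair (hG.neg_ne_self hu).symm, mul_one]

/-- **`P₂ = D²`**. [Kohel 1996, §2.4] [folklore] -/
theorem veluP₂_eq_veluD_sq (hG : IsOddSubgroupFinset G) : veluP₂ G = veluD G ^ 2 := by
  rw [veluP₂, veluD, ← Finset.prod_pow]
  exact prod_erase_zero_eq_prod_veluXVals hG (fun v => Polynomial.X - C (xOf v)) (fun c => (Polynomial.X - C c) ^ 2)
    fun v _ => by rw [xOf_neg, sq]

end KernelPoly

/-! ### The quadratics `q_{a,c}` and the norm polynomial `V_a` -/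

section Norm

variable {K : Type*} [Field K] {W : WeierstrassCurve K}

variable (W) in
/-- Blakestad–Grant's quadratic (5): for `x(v) = c` (and `y(v)² = f(c)`),
`(x - c)²·(x(P+v) - a)(x(P-v) - a) = q_{a,c}(x)` with
`q_{a,c}(X) = (c - a)²X² - 2((a + c)(a₄ + ac) + 2a₆)X + ((a₄ - ac)² - 4a₆(a + c))`.
[Blakestad–Grant 2023, eq. (5)] [cite: BlakestadGrant2023, Prop. 7] -/
def veluQa (a c : K) : K[X] :=
  C ((c - a) ^ 2) * Polynomial.X ^ 2 - C (2 * ((a + c) * (W.a₄ + a * c) + 2 * W.a₆)) * Polynomial.X +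
    C ((W.a₄ - a * c) ^ 2 - 4 * W.a₆ * (a + c))

/-- `deg q_{a,c} ≤ 2`. [folklore] -/
theorem natDegree_veluQa_le (a c : K) : (veluQa W a c).natDegree ≤ 2 := by
  unfold veluQa
  refine (natDegree_add_le _ _).trans (max_le ((natDegree_sub_le _ _).trans (max_le ?_ ?_)) ?_)
  · exact (natDegree_C_mul_le _ _).trans (natDegree_pow_le_of_le 2 natDegree_X_le)
  · exact (natDegree_C_mul_le _ _).trans (natDegree_X_le.trans (by norm_num))
  · rw [natDegree_C]; exact Nat.zero_le _

/-- `[X²] q_{a,c} = (c - a)²`. [folklore] -/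
theorem coeff_veluQa_two (a c : K) : (veluQa W a c).coeff 2 = (c - a) ^ 2 := by
  unfold veluQa
  simp only [coeff_add, coeff_sub, coeff_C_mul, coeff_X_pow, coeff_X, coeff_C]
  norm_num

/-- `q_{a,c}(x₀)` written out. [folklore] -/
theorem eval_veluQa (a c x₀ : K) : (veluQa W a c).eval x₀ =
    (c - a) ^ 2 * x₀ ^ 2 - 2 * ((a + c) * (W.a₄ + a * c) + 2 * W.a₆) * x₀ +
      ((W.a₄ - a * c) ^ 2 - 4 * W.a₆ * (a + c)) := by
  simp [veluQa]

variable [W.IsShortNF]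

/-- **Blakestad–Grant's (5)**: `(x₁ - x₂)²·(x(P+v) - a)·(x(P-v) - a) = q_{a,x₂}(x₁)` for
`P = (x₁, y₁)`, `v = (x₂, y₂)`, `x₁ ≠ x₂`. [Blakestad–Grant 2023, eq. (5)]
[cite: BlakestadGrant2023, Prop. 7] -/
theorem sq_mul_prod_xOf_sub {x₁ y₁ x₂ y₂ : K} (h₁ : W.toAffine.Nonsingular x₁ y₁)
    (h₂ : W.toAffine.Nonsingular x₂ y₂) (hx : x₁ ≠ x₂) (a : K) :
    (x₁ - x₂) ^ 2 * ((xOf (some x₁ y₁ h₁ + some x₂ y₂ h₂) - a) * (xOf (some x₁ y₁ h₁ - some x₂ y₂ h₂) - a)) =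
      (veluQa W a x₂).eval x₁ := by
  have hsum := sq_mul_xOf_add_add_xOf_sub h₁ h₂ hx
  have hprod := sq_mul_xOf_add_mul_xOf_sub h₁ h₂ hx
  have e₁ := yOf_sq_eq h₁
  have e₂ := yOf_sq_eq h₂
  rw [eval_veluQa]
  linear_combination hprod - a * hsum - 2 * a * e₁ - 2 * a * e₂

omit [W.IsShortNF] in
variable (G : Finset W.toAffine.Point) in
/-- **The norm polynomial** `V_a = (X - a)·Π_{c ∈ x(G ∖ O)} q_{a,c}` (degree `p = #G`, leading
coefficient `D(a)²`): `N(x - a) = V_a(x)/D(x)²`. [Blakestad–Grant 2023, proof of Prop. 7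
(`N(x - rᵢ) = Sᵢ(x)/φ_ψ(x)²`, `Sᵢ = p²V_{rᵢ}`)] [cite: BlakestadGrant2023, Prop. 7] -/
def veluV (a : K) : K[X] := (Polynomial.X - C a) * ∏ c ∈ veluXVals G, veluQa W a c

variable {G : Finset W.toAffine.Point}

omit [W.IsShortNF] in
/-- `deg V_a ≤ 2·#xVals + 1`. [folklore] -/
theorem natDegree_veluV_le (a : K) : (veluV G a).natDegree ≤ 2 * (veluXVals G).card + 1 := by
  rw [veluV, add_comm]
  refine natDegree_mul_le_of_le (natDegree_X_sub_C_le a) ?_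
  refine (natDegree_prod_le _ _).trans ?_
  refine (Finset.sum_le_sum fun c _ => natDegree_veluQa_le a c).trans ?_
  rw [Finset.sum_const, smul_eq_mul, mul_comm]

omit [W.IsShortNF] in
/-- `[X^{2n+1}] V_a = Π_c (c - a)² = D(a)²` (`n = #xVals`). [folklore] -/
theorem coeff_veluV (a : K) :
    (veluV G a).coeff (2 * (veluXVals G).card + 1) = (veluD G).eval a ^ 2 := by
  rw [veluV, add_comm (2 * _) 1, coeff_mul_add_eq_of_natDegree_le (natDegree_X_sub_C_le a)
    ((natDegree_prod_le _ _).trans ((Finset.sum_le_sum fun c _ => natDegree_veluQa_le a c).trans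
      (by rw [Finset.sum_const, smul_eq_mul, mul_comm]))), mul_comm 2 (veluXVals G).card,
    coeff_prod_of_natDegree_le (veluXVals G) (fun c => veluQa W a c) 2 fun c _ => natDegree_veluQa_le a c,
    eval_veluD, ← Finset.prod_pow]
  rw [coeff_sub, coeff_X_one, coeff_C, if_neg one_ne_zero, sub_zero, one_mul]
  refine Finset.prod_congr rfl fun c _ => ?_
  rw [coeff_veluQa_two]; ring

omit [W.IsShortNF] in
/-- `V_a(x₀) = (x₀ - a)·Π_c q_{a,c}(x₀)`. [folklore] -/
theorem eval_veluV (a x₀ : K) :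
    (veluV G a).eval x₀ = (x₀ - a) * ∏ c ∈ veluXVals G, (veluQa W a c).eval x₀ := by
  rw [veluV, eval_mul, eval_prod, eval_sub, eval_X, eval_C]

/-- **`N(x - a) = V_a(x)/D(x)²`**: for an affine point `P = (x, y)` with `x ∉ x(G ∖ O)`,
`D(x)²·Π_{v ∈ G}(x(P + v) - a) = V_a(x)`. [Blakestad–Grant 2023, proof of Prop. 7
(`N(x - rᵢ) = Sᵢ(x)/φ_ψ(x)²`, obtained "taking the product of (5) over the cosets … times
`x - rᵢ`")] [cite: BlakestadGrant2023, Prop. 7] -/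
theorem veluD_sq_mul_norm (hG : IsOddSubgroupFinset G) {x₀ y₀ : K} (h₀ : W.toAffine.Nonsingular x₀ y₀)
    (hgood : ∀ v ∈ G.erase 0, xOf v ≠ x₀) (a : K) :
    (veluD G).eval x₀ ^ 2 * ∏ v ∈ G, (xOf (some x₀ y₀ h₀ + v) - a) = (veluV G a).eval x₀ := by
  set P : W.toAffine.Point := some x₀ y₀ h₀ with hP
  have hsplit : ∏ v ∈ G, (xOf (P + v) - a) = (x₀ - a) * ∏ v ∈ G.erase 0, (xOf (P + v) - a) := by
    rw [← Finset.mul_prod_erase _ _ hG.zero_mem, add_zero, hP, xOf_some]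
  have hpair : ∏ v ∈ G.erase 0, (xOf (P + v) - a) =
      ∏ c ∈ veluXVals G, ((veluQa W a c).eval x₀ / (x₀ - c) ^ 2) := by
    refine prod_erase_zero_eq_prod_veluXVals hG (fun v => xOf (P + v) - a)
      (fun c => (veluQa W a c).eval x₀ / (x₀ - c) ^ 2) fun v hv => ?_
    have hv0 : v ≠ 0 := (Finset.mem_erase.mp hv).1
    rcases v with _ | ⟨x₂, y₂, h₂⟩
    · exact (hv0 rfl).elim
    have hx : x₀ ≠ x₂ := fun h => hgood _ hv (by rw [xOf_some, h])
    have hx' : (x₀ - x₂) ^ 2 ≠ 0 := pow_ne_zero 2 (sub_ne_zero.mpr hx)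
    rw [xOf_some, eq_div_iff hx', ← sq_mul_prod_xOf_sub h₀ h₂ hx a, hP, sub_eq_add_neg (some x₀ y₀ h₀) (some x₂ y₂ h₂)]
    ring
  rw [hsplit, hpair, eval_veluV, Finset.prod_div_distrib, eval_veluD, ← Finset.prod_pow]
  have hD : ∏ c ∈ veluXVals G, (x₀ - c) ^ 2 ≠ 0 := by
    rw [Finset.prod_pow]; exact pow_ne_zero 2 (by rw [← eval_veluD]; exact eval_veluD_ne_zero hgood)
  field_simp

omit [W.IsShortNF] in
/-- **Translation invariance of products over `G`**: `Π_{v ∈ G} ψ(u + v) = Π_{v ∈ G} ψ(v)` for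
`u ∈ G`. [folklore] -/
theorem IsOddSubgroupFinset.prod_comp_add_left (hG : IsOddSubgroupFinset G) {M : Type*} [CommMonoid M]
    (ψ : W.toAffine.Point → M) {u : W.toAffine.Point} (hu : u ∈ G) :
    ∏ v ∈ G, ψ (u + v) = ∏ v ∈ G, ψ v :=
  Finset.prod_nbij' (fun v => u + v) (fun v => -u + v) (fun v hv => hG.add_mem u hu v hv)
    (fun v hv => hG.add_mem _ (hG.neg_mem u hu) v hv) (fun v _ => by abel) (fun v _ => by abel)
    (fun v _ => rfl)

omit [W.IsShortNF] in
/-- **`G`-invariance of the norm**: `Π_{v ∈ G}(x(P + u + v) - a) = Π_{v ∈ G}(x(P + v) - a)` for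
`u ∈ G` (`N = Π_u τ_u^*`). [Blakestad–Grant 2023, proof of Prop. 7] [folklore] -/
theorem norm_add_eq (hG : IsOddSubgroupFinset G) (P : W.toAffine.Point) {u : W.toAffine.Point}
    (hu : u ∈ G) (a : K) :
    ∏ v ∈ G, (xOf (P + u + v) - a) = ∏ v ∈ G, (xOf (P + v) - a) := by
  simp_rw [add_assoc]
  exact hG.prod_comp_add_left (fun v => xOf (P + v) - a) hu

end Norm

/-! ### `ψ^*ω₁ = ω`: `S = U'P₂ - UP₂'`, and the `y`-numerator `M_D = U'D - 2UD'` -/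

section Differential

variable {K : Type*} [Field K] {W : WeierstrassCurve K} {G : Finset W.toAffine.Point}

/-- **`S = U'·P₂ - U·P₂'`**, i.e. `y₁ = yS/P₂² = y·(U/P₂)' = ½ D(x₁)`: Vélu's isogeny
`(x, y) ↦ (x₁, y₁)` pulls the invariant differential `dx₁/2y₁` back to `dx/2y`.
Termwise, with `P₂ = (X - x_v)²Q_v` and `g_v = (t_vX + w_v)Q_v`:
`g_v'P₂ - g_vP₂' = Q_v²(X - x_v)(-t_vX - t_vx_v - 2w_v)`. [Vélu 1971 (the isogeny is
normalised: `ψ^*(dX/2Y) = dx/2y`); Kohel 1996, §2.4] [cite: Velu1971] -/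
theorem veluS_eq_derivative (hG : IsOddSubgroupFinset G) :
    veluS G = derivative (veluU G) * veluP₂ G - veluU G * derivative (veluP₂ G) := by
  have hterm : ∀ v ∈ G.erase 0,
      derivative ((C (veluT v) * Polynomial.X + C (veluWc v)) * veluQ G v) * veluP₂ G -
        (C (veluT v) * Polynomial.X + C (veluWc v)) * veluQ G v * derivative (veluP₂ G) =
      veluQ G v ^ 2 * (Polynomial.X - C (xOf v)) *
        (C (-veluT v) * Polynomial.X + C (-veluT v * xOf v - 2 * veluWc v)) := by
    intro v hv
    rw [← sq_mul_veluQ hG hv]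
    simp only [derivative_mul, derivative_add, derivative_X, derivative_C, derivative_sq, map_neg,
      map_sub, map_mul, map_ofNat]
    ring
  have hsum : derivative (veluU₁ G) * veluP₂ G - veluU₁ G * derivative (veluP₂ G) = veluS₁ G := by
    rw [veluU₁, veluS₁, derivative_C_mul, derivative_sum, mul_assoc, mul_assoc, ← mul_sub,
      Finset.sum_mul, Finset.sum_mul, ← Finset.sum_sub_distrib]
    congr 1
    exact Finset.sum_congr rfl fun v hv => hterm v hv
  rw [veluS, veluU, ← hsum]
  simp only [derivative_add, derivative_mul, derivative_X, one_mul]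
  ring

variable (G) in
/-- **The `y`-numerator in kernel-polynomial form**, `M_D = U'·D - 2U·D'` (Kohel; Blakestad–Grant's
`M(x)`, `y_p = yM(x)/φ_ψ(x)³`): `y₁ = y·M_D/D³`. [Kohel 1996, §2.4; Blakestad–Grant 2023, proof
of Prop. 7] [cite: BlakestadGrant2023, Prop. 7] -/
def veluMD : K[X] := derivative (veluU G) * veluD G - 2 * veluU G * derivative (veluD G)

/-- **`S = D·M_D`** (from `S = U'P₂ - UP₂'` and `P₂ = D²`). [Kohel 1996, §2.4] [folklore] -/
theorem veluS_eq_veluD_mul (hG : IsOddSubgroupFinset G) : veluS G = veluD G * veluMD G := by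
  rw [veluS_eq_derivative hG, veluP₂_eq_veluD_sq hG, veluMD, derivative_sq]
  simp only [map_ofNat]
  ring

/-- `deg U' ≤ 2n` (`n = #xVals`). [folklore] -/
theorem natDegree_derivative_veluU_le (hG : IsOddSubgroupFinset G) :
    (derivative (veluU G)).natDegree ≤ 2 * (veluXVals G).card := by
  refine (natDegree_derivative_le _).trans ?_
  rw [natDegree_veluU hG, card_erase_zero_eq hG]
  omega

/-- `xVals = ∅ ⇒ D = 1`. [folklore] -/
theorem veluD_eq_one_of_card_eq_zero (h : (veluXVals G).card = 0) : veluD G = 1 := by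
  rw [veluD, Finset.card_eq_zero.mp h, Finset.prod_empty]

/-- `2·q = C 2 · q` in `K[X]`. [folklore] -/
theorem two_mul_eq_C_mul (q : K[X]) : 2 * q = C (2 : K) * q := by
  rw [map_ofNat]

/-- `deg M_D ≤ 3n` (`n = #xVals`). [folklore] -/
theorem natDegree_veluMD_le (hG : IsOddSubgroupFinset G) :
    (veluMD G).natDegree ≤ 3 * (veluXVals G).card := by
  set n := (veluXVals G).card with hn
  have hU : (veluU G).natDegree = 2 * n + 1 := by rw [natDegree_veluU hG, card_erase_zero_eq hG]
  have hD : (veluD G).natDegree = n := natDegree_veluD G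
  have h1 : (derivative (veluU G) * veluD G).natDegree ≤ 3 * n :=
    (natDegree_mul_le_of_le (natDegree_derivative_veluU_le hG) hD.le).trans (by omega)
  have h2 : (2 * veluU G * derivative (veluD G)).natDegree ≤ 3 * n := by
    rcases Nat.eq_zero_or_pos n with h0 | hpos
    · rw [veluD_eq_one_of_card_eq_zero (hn.symm.trans h0), derivative_one, mul_zero, natDegree_zero]
      exact Nat.zero_le _
    · have h2U : (2 * veluU G).natDegree ≤ 2 * n + 1 := by
        rw [two_mul_eq_C_mul]; exact (natDegree_C_mul_le _ _).trans hU.le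
      have hD' : (derivative (veluD G)).natDegree ≤ n - 1 := (natDegree_derivative_le _).trans (by rw [hD])
      exact (natDegree_mul_le_of_le h2U hD').trans (by omega)
  exact (natDegree_sub_le _ _).trans (max_le h1 h2)

/-- `[X^{3n}] M_D = (2n + 1) - 2n = 1`. [folklore] -/
theorem coeff_veluMD (hG : IsOddSubgroupFinset G) :
    (veluMD G).coeff (3 * (veluXVals G).card) = 1 := by
  set n := (veluXVals G).card with hn
  have hU : (veluU G).natDegree = 2 * n + 1 := by rw [natDegree_veluU hG, card_erase_zero_eq hG]
  have hUtop : (veluU G).coeff (2 * n + 1) = 1 := by rw [← hU]; exact (monic_veluU hG).coeff_natDegree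
  have hD : (veluD G).natDegree = n := natDegree_veluD G
  have hDtop : (veluD G).coeff n = 1 := by rw [← hD]; exact (monic_veluD G).coeff_natDegree
  have h1 : (derivative (veluU G) * veluD G).coeff (3 * n) = 2 * n + 1 := by
    rw [show 3 * n = 2 * n + n by ring, coeff_mul_add_eq_of_natDegree_le (natDegree_derivative_veluU_le hG) hD.le,
      coeff_derivative, hUtop, hDtop]
    push_cast; ring
  have h2 : (2 * veluU G * derivative (veluD G)).coeff (3 * n) = 2 * n := by
    rcases Nat.eq_zero_or_pos n with h0 | hpos
    · rw [veluD_eq_one_of_card_eq_zero (hn.symm.trans h0), derivative_one, mul_zero, coeff_zero, h0,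
        Nat.cast_zero, mul_zero]
    · have h2U : (2 * veluU G).natDegree ≤ 2 * n + 1 := by
        rw [two_mul_eq_C_mul]; exact (natDegree_C_mul_le _ _).trans hU.le
      have hD' : (derivative (veluD G)).natDegree ≤ n - 1 := (natDegree_derivative_le _).trans (by rw [hD])
      have hcast : ((n - 1 : ℕ) : K) + 1 = n := by
        rw [Nat.cast_sub (Nat.one_le_iff_ne_zero.mpr hpos.ne'), Nat.cast_one]; ring
      rw [show 3 * n = (2 * n + 1) + (n - 1) by omega, coeff_mul_add_eq_of_natDegree_le h2U hD',
        coeff_derivative, Nat.sub_add_cancel hpos, hDtop, hcast, two_mul_eq_C_mul, coeff_C_mul, hUtop]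
      ring
  rw [veluMD, coeff_sub, h1, h2]
  ring

/-- **`M_D` is monic of degree `3n`** (`3n = (3p - 3)/2` for `#G = p`; Blakestad–Grant: "`M(x)`
of degree `(3p-3)/2` … has a lead coefficient that is a unit"). [Blakestad–Grant 2023, Prop. 7]
[folklore] -/
theorem monic_veluMD (hG : IsOddSubgroupFinset G) : (veluMD G).Monic :=
  monic_of_natDegree_le_of_coeff_eq_one _ (natDegree_veluMD_le hG) (coeff_veluMD hG)

/-- `deg M_D = 3n`. [folklore] -/
theorem natDegree_veluMD (hG : IsOddSubgroupFinset G) :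
    (veluMD G).natDegree = 3 * (veluXVals G).card :=
  le_antisymm (natDegree_veluMD_le hG) (le_natDegree_of_ne_zero (by rw [coeff_veluMD hG]; exact one_ne_zero))

end Differential

/-! ### The defect `μ_a` -/

section Mu

variable {K : Type*} [Field K] {W : WeierstrassCurve K} (G : Finset W.toAffine.Point)

/-- The constant `μ_a = [X^{2n}](V_a - D(a)²U)` for which `N(x - a) = D(a)²x₁ + μ_a`
(`veluV_eq`); for a root `r` of `f`, `μ_r = -U(r)` (`veluMu_eq_of_root`). [Blakestad–Grant 2023,
proof of Prop. 7 (the constants `cᵢ², rᵢ'`)] [folklore] -/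
def veluMu (a : K) : K := (veluV G a - C ((veluD G).eval a ^ 2) * veluU G).coeff (2 * (veluXVals G).card)

variable {G}

/-- `deg (V_a - D(a)²U - μ_aD²) ≤ 2n - 1` (`n = #xVals ≥ 1`). [folklore] -/
theorem natDegree_veluV_sub_le (hG : IsOddSubgroupFinset G) (hn : 1 ≤ (veluXVals G).card) (a : K) :
    (veluV G a - C ((veluD G).eval a ^ 2) * veluU G - C (veluMu G a) * veluD G ^ 2).natDegree ≤
      2 * (veluXVals G).card - 1 := by
  set n := (veluXVals G).card with hn'
  have hU : (veluU G).natDegree = 2 * n + 1 := by rw [natDegree_veluU hG, card_erase_zero_eq hG]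
  have hD2 : (veluD G ^ 2).natDegree = 2 * n := by
    rw [natDegree_pow, natDegree_veluD, ← hn']
  have h1 : (veluV G a - C ((veluD G).eval a ^ 2) * veluU G).natDegree ≤ 2 * n := by
    refine Polynomial.natDegree_sub_le_of_coeff_eq (natDegree_veluV_le a) ((natDegree_C_mul_le _ _).trans hU.le) ?_
    rw [coeff_veluV, coeff_C_mul, ← hU, (monic_veluU hG).coeff_natDegree, mul_one]
  have h2n : 2 * n = (2 * n - 1) + 1 := by omega
  refine Polynomial.natDegree_sub_le_of_coeff_eq (h1.trans h2n.le)
    ((natDegree_C_mul_le _ _).trans (hD2.le.trans h2n.le)) ?_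
  have htop : (veluD G ^ 2).coeff (2 * n) = 1 := by rw [← hD2]; exact ((monic_veluD G).pow 2).coeff_natDegree
  rw [← h2n, coeff_C_mul, htop, mul_one]
  unfold veluMu
  rw [← hn']


variable (G) in
/-- `ρ_r = U(r)/D(r)²` — the value `x₁(ψ(r, 0))` of Vélu's `x`-map at a `2`-torsion point; for
the three roots of `f` these are the roots `rᵢ'` of the Vélu cubic. [Blakestad–Grant 2023, proof
of Prop. 7 (`rᵢ'`)] [folklore] -/
def veluRho (r : K) : K := (veluU G).eval r / (veluD G).eval r ^ 2

/-- A nonzero point is `(x(P), y(P))`. [folklore] -/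
theorem exists_eq_some_xOf_yOf {P : W.toAffine.Point} (hP : P ≠ 0) :
    ∃ h : W.toAffine.Nonsingular (xOf P) (yOf P), P = some (xOf P) (yOf P) h := by
  rcases P with _ | ⟨x, y, h⟩
  · exact (hP rfl).elim
  · exact ⟨h, rfl⟩

end Mu

/-! ### Base change of the new data along a field extension -/

section BaseChange

variable {K : Type*} [Field K] (W : WeierstrassCurve K) {L : Type*} [Field L] [Algebra K L]

/-- The base change `W(K) → W(L)` on points. -/
local notation "mapL" => (map (W' := W) (Algebra.ofId K L))

variable {G : Finset (W⁄K).toAffine.Point}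

/-- `x(G ∖ O)` commutes with base change. [folklore] -/
theorem veluXVals_image : veluXVals (G.image mapL) = (veluXVals G).image (algebraMap K L) := by
  rw [veluXVals, image_erase_zero, Finset.image_image, veluXVals, Finset.image_image]
  exact Finset.image_congr fun v _ => xOf_map W v

/-- `D` commutes with base change. [folklore] -/
theorem veluD_image : veluD (G.image mapL) = (veluD G).map (algebraMap K L) := by
  rw [veluD, veluXVals_image, Finset.prod_image fun a _ b _ h => (algebraMap K L).injective h, veluD,
    Polynomial.map_prod]
  exact Finset.prod_congr rfl fun c _ => by rw [Polynomial.map_sub, map_X, map_C]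

/-- `q_{a,c}` under base change. [folklore] -/
theorem veluQa_map (a c : K) : (veluQa (W⁄K) a c).map (algebraMap K L) =
    veluQa (W⁄L) (algebraMap K L a) (algebraMap K L c) := by
  have ha4 : algebraMap K L ((W⁄K).a₄) = (W⁄L).a₄ := rfl
  have ha6 : algebraMap K L ((W⁄K).a₆) = (W⁄L).a₆ := rfl
  simp only [veluQa, Polynomial.map_add, Polynomial.map_sub, Polynomial.map_mul, Polynomial.map_pow,
    map_C, map_X, map_pow, map_sub, map_mul, map_add, map_ofNat, Polynomial.map_ofNat, ha4, ha6]

/-- `V_a` commutes with base change. [folklore] -/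
theorem veluV_image (a : K) : veluV (G.image mapL) (algebraMap K L a) = (veluV G a).map (algebraMap K L) := by
  rw [veluV, veluXVals_image, Finset.prod_image fun a _ b _ h => (algebraMap K L).injective h, veluV,
    Polynomial.map_mul, Polynomial.map_sub, map_X, map_C, Polynomial.map_prod]
  exact congrArg _ (Finset.prod_congr rfl fun c _ => (veluQa_map W a c).symm)

/-- `D(a)` under base change. [folklore] -/
theorem eval_veluD_image (a : K) :
    (veluD (G.image mapL)).eval (algebraMap K L a) = algebraMap K L ((veluD G).eval a) := by
  rw [veluD_image, eval_map, eval₂_hom]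

end BaseChange

end WeierstrassCurve.Affine.Point

/-! ### The vanishing lemma at the formal point and `N(x - a) = D(a)²x₁ + μ_a` -/

namespace WeierstrassCurve

section LaurentPoint

open PowerSeries Affine Affine.Point
open scoped LaurentSeries

variable {F : Type*} [Field F] (W : WeierstrassCurve F) [W.IsShortNF] [W.IsElliptic]

local notation "𝓛" => LaurentSeries F
local notation "ιL" => (HahnSeries.ofPowerSeries ℤ F)

/-- **Multiplicity bound from `G`-invariance.** Let `Q ∈ F[X]`, `e ∈ ℕ`, and suppose the
function `Q(x)/D(x)^e` takes the same value at the formal point `T` and at its translate `T + u`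
by a point `u ∈ G ∖ O` (read in `F((z))`: `Q(x(T))·D(x(T+u))^e = Q(x(T+u))·D(x(T))^e`). Then
`mult_{x(u)}(Q) + 2·deg Q ≥ e·(2n + 1)` (`n = #x(G ∖ O)`): `D(x(T)) ∼ z^{-2n}` and `Q(x(T)) ∼
z^{-2 deg Q}`, while `x(T + u) = x(u) + 2y(u)z + ⋯` (`y(u) ≠ 0`) meets `X - x(u)` simply, so
`D(x(T+u)) ∼ z` and `Q(x(T+u)) ∼ z^{mult}`. [Vélu 1971; the engine of
`X_sub_C_pow_ten_dvd_veluN` of the prequel] [folklore] -/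
theorem le_rootMultiplicity_of_laurent_invariant [CharZero F] {G : Finset (W⁄F).toAffine.Point}
    (hG : IsOddSubgroupFinset G) {Q : Polynomial F} (hQ : Q ≠ 0) (e : ℕ)
    {u : (W⁄F).toAffine.Point} (hu : u ∈ G.erase 0)
    (hinv : ∀ (Φ : F⟦X⟧) (y' : 𝓛) (h' : (W⁄𝓛).toAffine.Nonsingular (ιL Φ) y'),
      Point.some _ _ W.nonsingular_formalPoint + Point.map (Algebra.ofId F 𝓛) u = Point.some (ιL Φ) y' h' →
      (Q.map (algebraMap F 𝓛)).eval (ιL W.formalXMulSq * (ιL PowerSeries.X)⁻¹ ^ 2) *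
          ((veluD G).map (algebraMap F 𝓛)).eval (ιL Φ) ^ e =
        (Q.map (algebraMap F 𝓛)).eval (ιL Φ) *
          ((veluD G).map (algebraMap F 𝓛)).eval (ιL W.formalXMulSq * (ιL PowerSeries.X)⁻¹ ^ 2) ^ e) :
    e * (2 * (veluXVals G).card + 1) ≤ Q.rootMultiplicity (xOf u) + 2 * Q.natDegree := by
  have ht := ofPowerSeries_X_ne_zero (F := F)
  have hu0 : u ≠ 0 := (Finset.mem_erase.mp hu).1
  have huG : u ∈ G := (Finset.mem_erase.mp hu).2
  rcases u with _ | ⟨r, s, hrs⟩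
  · exact (hu0 rfl).elim
  rw [xOf_some]
  -- `s ≠ 0` (no `2`-torsion)
  have hs : s ≠ 0 := by
    intro hs0
    refine hu0 (hG.eq_zero_of_neg_eq _ huG ?_)
    rw [neg_some]
    congr 1
    rw [negY_of_isShortNF, hs0, _root_.neg_zero]
  have hs2 : (2 : F) * s ≠ 0 := mul_ne_zero two_ne_zero hs
  obtain ⟨Φ, y', h', hΦ0, hΦ1, hTu⟩ := W.exists_formalPoint_add_eq hrs
  have hid := hinv Φ y' h' hTu
  rw [eval_map_ofPowerSeries, eval_map_ofPowerSeries] at hid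
  set n := (veluXVals G).card with hndef
  set d := Q.natDegree with hddef
  have hDdeg : (veluD G).natDegree ≤ n := (natDegree_veluD G).le
  have hevQ := W.eval_map_formalX_mul Q le_rfl
  have hevD := W.eval_map_formalX_mul (veluD G) hDdeg
  have key : ιL (W.clearedEval d Q * Polynomial.aeval Φ (veluD G) ^ e * PowerSeries.X ^ (2 * n * e)) =
      ιL (Polynomial.aeval Φ Q * W.clearedEval n (veluD G) ^ e * PowerSeries.X ^ (2 * d)) := by
    rw [map_mul, map_mul, map_pow, map_pow, map_mul, map_mul, map_pow, map_pow, ← hevQ, ← hevD, mul_pow,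
      ← pow_mul]
    linear_combination (ιL PowerSeries.X) ^ (2 * d) * (ιL PowerSeries.X) ^ (2 * n * e) * hid
  have keyPS := HahnSeries.ofPowerSeries_injective key
  -- factor `Q = (X - r)^k Q₁`, `D = (X - r)·D₁`, `Φ - r = z·E`
  set k := Q.rootMultiplicity r with hkdef
  obtain ⟨Q₁, hQfac, hQ₁⟩ := Q.exists_eq_pow_rootMultiplicity_mul_and_not_dvd hQ r
  have hQ₁r : Q₁.eval r ≠ 0 := fun h0 => hQ₁ (Polynomial.dvd_iff_isRoot.mpr h0)
  have hrmem : r ∈ veluXVals G := Finset.mem_image.mpr ⟨_, hu, xOf_some hrs⟩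
  set D₁ := ∏ c ∈ (veluXVals G).erase r, (Polynomial.X - Polynomial.C c) with hD₁
  have hDfac : veluD G = (Polynomial.X - Polynomial.C r) * D₁ := by
    rw [veluD, ← Finset.mul_prod_erase _ _ hrmem]
  have hD₁r : D₁.eval r ≠ 0 := by
    rw [hD₁, Polynomial.eval_prod]
    refine Finset.prod_ne_zero_iff.mpr fun c hc => ?_
    rw [Polynomial.eval_sub, Polynomial.eval_X, Polynomial.eval_C]
    exact sub_ne_zero.mpr (Finset.ne_of_mem_erase hc).symm
  obtain ⟨E, hE⟩ : (PowerSeries.X : F⟦X⟧) ∣ Φ - PowerSeries.C r := by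
    rw [PowerSeries.X_dvd_iff, map_sub, hΦ0, constantCoeff_C, sub_self]
  have hE0 : constantCoeff E ≠ 0 := by
    have h1 := congrArg (coeff 1) hE
    rw [map_sub, coeff_C, if_neg one_ne_zero, sub_zero, hΦ1, coeff_succ_X_mul,
      coeff_zero_eq_constantCoeff_apply] at h1
    rw [← h1]; exact hs2
  have hevD0 : constantCoeff (W.clearedEval n (veluD G)) = 1 := by
    rw [W.constantCoeff_clearedEval hDdeg, hndef, ← natDegree_veluD G]
    exact (monic_veluD G).coeff_natDegree
  have hCr : Polynomial.aeval Φ (Polynomial.X - Polynomial.C r) = PowerSeries.X * E := by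
    rw [map_sub, Polynomial.aeval_X, Polynomial.aeval_C, ← hE]
    simp
  have haevQ : Polynomial.aeval Φ Q = PowerSeries.X ^ k * (E ^ k * Polynomial.aeval Φ Q₁) := by
    conv_lhs => rw [hQfac]
    rw [map_mul, map_pow, hCr]
    ring
  have haevD : Polynomial.aeval Φ (veluD G) = PowerSeries.X * (E * Polynomial.aeval Φ D₁) := by
    conv_lhs => rw [hDfac]
    rw [map_mul, hCr]
    ring
  rw [haevQ, haevD] at keyPS
  have hB0 : constantCoeff (E ^ k * Polynomial.aeval Φ Q₁ * W.clearedEval n (veluD G) ^ e) ≠ 0 := by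
    rw [map_mul, map_mul, map_pow, map_pow, hevD0, one_pow, mul_one, constantCoeff_aeval, hΦ0]
    exact mul_ne_zero (pow_ne_zero _ hE0) hQ₁r
  have hshape : PowerSeries.X ^ (e + 2 * n * e) *
      (W.clearedEval d Q * (E * Polynomial.aeval Φ D₁) ^ e) =
      PowerSeries.X ^ (k + 2 * d) * (E ^ k * Polynomial.aeval Φ Q₁ * W.clearedEval n (veluD G) ^ e) := by
    rw [pow_add, pow_add]
    linear_combination keyPS
  -- compare the coefficients of `z^{k+2d}`
  have hk : e + 2 * n * e ≤ k + 2 * d := by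
    by_contra hlt
    push Not at hlt
    have h := congrArg (coeff (k + 2 * d)) hshape
    rw [coeff_X_pow_mul', coeff_X_pow_mul', if_neg (not_le.mpr hlt), if_pos le_rfl, Nat.sub_self,
      coeff_zero_eq_constantCoeff] at h
    exact hB0 h.symm
  calc e * (2 * n + 1) = e + 2 * n * e := by ring
    _ ≤ k + 2 * d := hk

/-- **Vanishing lemma**: a `G`-invariant function `Q(x)/D(x)^e` with `deg Q < e·n` is zero.
Indeed each of the `n` values `x(u)` is a root of `Q` of multiplicity `≥ e(2n+1) - 2 deg Q`
(`le_rootMultiplicity_of_laurent_invariant`), so `D^{e(2n+1) - 2 deg Q} ∣ Q`, and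
`n·(e(2n+1) - 2 deg Q) > deg Q` exactly when `deg Q < e·n`. [Vélu 1971 (the functions `X`, `Y`
have their only poles along the kernel); the divisor-free substitute for "a function with too
few poles is constant"] [folklore] -/
theorem eq_zero_of_laurent_invariant [CharZero F] {G : Finset (W⁄F).toAffine.Point}
    (hG : IsOddSubgroupFinset G) (Q : Polynomial F) (e : ℕ)
    (hdeg : Q.natDegree < e * (veluXVals G).card)
    (hinv : ∀ u ∈ G.erase 0, ∀ (Φ : F⟦X⟧) (y' : 𝓛) (h' : (W⁄𝓛).toAffine.Nonsingular (ιL Φ) y'),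
      Point.some _ _ W.nonsingular_formalPoint + Point.map (Algebra.ofId F 𝓛) u = Point.some (ιL Φ) y' h' →
      (Q.map (algebraMap F 𝓛)).eval (ιL W.formalXMulSq * (ιL PowerSeries.X)⁻¹ ^ 2) *
          ((veluD G).map (algebraMap F 𝓛)).eval (ιL Φ) ^ e =
        (Q.map (algebraMap F 𝓛)).eval (ιL Φ) *
          ((veluD G).map (algebraMap F 𝓛)).eval (ιL W.formalXMulSq * (ιL PowerSeries.X)⁻¹ ^ 2) ^ e) :
    Q = 0 := by
  by_contra hQ
  set n := (veluXVals G).card with hndef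
  set d := Q.natDegree with hddef
  set k₀ := e * (2 * n + 1) - 2 * d with hk₀def
  have hk₀ : k₀ + 2 * d = e * (2 * n + 1) := Nat.sub_add_cancel (by nlinarith)
  -- `Π_{c ∈ xVals} (X - c)^{k₀} ∣ Q`
  have hdvd : ∏ c ∈ veluXVals G, (Polynomial.X - Polynomial.C c) ^ k₀ ∣ Q := by
    refine Finset.prod_dvd_of_coprime ?_ ?_
    · intro a _ b _ hab
      exact (Polynomial.isCoprime_X_sub_C_of_isUnit_sub (sub_ne_zero.mpr hab).isUnit).pow
    · intro c hc
      obtain ⟨u, hu, rfl⟩ := Finset.mem_image.mp hc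
      have hle := W.le_rootMultiplicity_of_laurent_invariant hG hQ e hu (hinv u hu)
      rw [← hndef, ← hddef] at hle
      have hk : k₀ ≤ Q.rootMultiplicity (xOf u) := by omega
      exact (pow_dvd_pow _ hk).trans (Q.pow_rootMultiplicity_dvd (xOf u))
  have hdeg₁ : (∏ c ∈ veluXVals G, (Polynomial.X - Polynomial.C c) ^ k₀).natDegree = n * k₀ := by
    rw [Polynomial.natDegree_prod_of_monic _ _ fun c _ => (Polynomial.monic_X_sub_C c).pow k₀]
    simp only [Polynomial.natDegree_pow, Polynomial.natDegree_X_sub_C, mul_one, Finset.sum_const,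
      smul_eq_mul, hndef]
  have hdeg₂ := Polynomial.natDegree_le_of_dvd hdvd hQ
  rw [hdeg₁] at hdeg₂
  nlinarith

/-- **`N(x - a) = D(a)²·x₁ + μ_a`** (Blakestad–Grant's "comparing divisors"): for every `a`,

  `V_a = D(a)²·U + μ_a·D²`  in `F[X]`,

i.e. the norm `Π_{v ∈ G} τ_v^*(x - a)` is the affine function `D(a)²x₁ + μ_a` of Vélu's
`x₁ = U/D²`. Proof: `V_a - D(a)²U - μ_aD²` has degree `≤ 2n - 1 < 2n` and the function
`(V_a - D(a)²U - μ_aD²)/D² = N(x-a) - D(a)²x₁ - μ_a` is `G`-invariant; apply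
`eq_zero_of_laurent_invariant` with `e = 2`. [Blakestad–Grant 2023, proof of Prop. 7 ("comparing
divisors, there are constants `cᵢ` … such that `x_p - rᵢ' = cᵢ²N(x - rᵢ)`"); here for all `a`,
without divisors] [cite: BlakestadGrant2023, Prop. 7] -/
theorem veluV_eq [CharZero F] {G : Finset (W⁄F).toAffine.Point} (hG : IsOddSubgroupFinset G) (a : F) :
    veluV G a = Polynomial.C ((veluD G).eval a ^ 2) * veluU G + Polynomial.C (veluMu G a) * veluD G ^ 2 := by
  set n := (veluXVals G).card with hndef
  rcases Nat.eq_zero_or_pos n with hn0 | hnpos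
  · -- `G = O`: `V_a = X - a`, `U = X`, `D = 1`, `μ_a = -a`
    have hX : veluXVals G = ∅ := Finset.card_eq_zero.mp (hndef.symm.trans hn0 ▸ rfl)
    have hE : G.erase 0 = ∅ := by
      have := card_erase_zero_eq hG; rw [← hndef, hn0, mul_zero] at this
      exact Finset.card_eq_zero.mp this
    have hD : veluD G = 1 := by rw [veluD, hX, Finset.prod_empty]
    have hV : veluV G a = Polynomial.X - Polynomial.C a := by rw [veluV, hX, Finset.prod_empty, mul_one]
    have hU : veluU G = Polynomial.X := by
      rw [veluU, veluP₂, veluU₁, hE, Finset.prod_empty, Finset.sum_empty, mul_one, mul_zero, add_zero]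
    have hμ : veluMu G a = -a := by
      rw [veluMu, ← hndef, hn0, hV, hD, hU, Polynomial.eval_one, one_pow, map_one, one_mul]
      simp
    rw [hV, hD, hU, hμ, Polynomial.eval_one, one_pow, map_one, one_mul, one_pow, mul_one, map_neg,
      sub_eq_add_neg]
  -- `n ≥ 1`: the vanishing lemma for `Q = V_a - D(a)²U - μ_aD²`, `e = 2`
  set Q := veluV G a - Polynomial.C ((veluD G).eval a ^ 2) * veluU G - Polynomial.C (veluMu G a) * veluD G ^ 2
    with hQdef
  suffices hQ0 : Q = 0 by
    rw [hQdef, sub_eq_zero, sub_eq_iff_eq_add] at hQ0; rw [hQ0]; ring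
  have hdegQ : Q.natDegree < 2 * n := by
    have := natDegree_veluV_sub_le hG hnpos a
    rw [← hndef, ← hQdef] at this
    omega
  refine W.eq_zero_of_laurent_invariant hG Q 2 (by rw [← hndef]; linarith) fun u hu Φ y' h' hTu => ?_
  have ht := ofPowerSeries_X_ne_zero (F := F)
  have hu0 : u ≠ 0 := (Finset.mem_erase.mp hu).1
  have huG : u ∈ G := (Finset.mem_erase.mp hu).2
  rcases u with _ | ⟨r, s, hrs⟩
  · exact (hu0 rfl).elim
  have hs : s ≠ 0 := by
    intro hs0
    refine hu0 (hG.eq_zero_of_neg_eq _ huG ?_)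
    rw [neg_some]
    congr 1
    rw [negY_of_isShortNF, hs0, _root_.neg_zero]
  have hs2 : (2 : F) * s ≠ 0 := mul_ne_zero two_ne_zero hs
  obtain ⟨Φ₀, y₀', h₀', hΦ0, hΦ1, hTu₀⟩ := W.exists_formalPoint_add_eq hrs
  -- the data `Φ` of the hypothesis coincide with `Φ₀`
  have hPeq : Point.some (ιL Φ) y' h' = Point.some (ιL Φ₀) y₀' h₀' := hTu.symm.trans hTu₀
  have hΦeq : Φ = Φ₀ := by
    have := congrArg xOf hPeq
    rw [xOf_some, xOf_some] at this
    exact HahnSeries.ofPowerSeries_injective this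
  subst hΦeq
  set G' := G.image (Point.map (W' := W) (Algebra.ofId F 𝓛)) with hG'
  have hG'odd : IsOddSubgroupFinset G' := hG.image W
  have hu' : Point.map (W' := W) (Algebra.ofId F 𝓛) (Point.some r s hrs) ∈ G' :=
    Finset.mem_image_of_mem _ huG
  have hgood₁ : ∀ w ∈ G'.erase 0, xOf w ≠ ιL W.formalXMulSq * (ιL PowerSeries.X)⁻¹ ^ 2 := by
    intro w hw
    rw [hG', image_erase_zero] at hw
    obtain ⟨v, -, rfl⟩ := Finset.mem_image.mp hw
    rw [xOf_map]
    exact (W.formalX_ne_algebraMap _).symm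
  have hgood₂ : ∀ w ∈ G'.erase 0, xOf w ≠ ιL Φ := by
    intro w hw
    rw [hG', image_erase_zero] at hw
    obtain ⟨v, -, rfl⟩ := Finset.mem_image.mp hw
    rw [xOf_map]
    exact (ofPowerSeries_ne_algebraMap (by rw [hΦ1]; exact hs2) _).symm
  set a' := algebraMap F 𝓛 a with ha'
  -- norms and Vélu sums at `T` and `T + u`
  have hN₁ := veluD_sq_mul_norm hG'odd W.nonsingular_formalPoint hgood₁ a'
  have hN₂ := veluD_sq_mul_norm hG'odd h' hgood₂ a'
  have hNinv : ∏ v ∈ G', (xOf (Point.some (ιL Φ) y' h' + v) - a') =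
      ∏ v ∈ G', (xOf (Point.some _ _ W.nonsingular_formalPoint + v) - a') := by
    rw [← hTu]
    exact norm_add_eq hG'odd _ hu' a'
  have hx₁ := veluP₂_mul_sum_xOf hG'odd two_ne_zero_laurent W.nonsingular_formalPoint hgood₁
  have hx₂ := veluP₂_mul_sum_xOf hG'odd two_ne_zero_laurent h' hgood₂
  have hsumx : ∑ v ∈ G', xOf (Point.some (ιL Φ) y' h' + v) =
      ∑ v ∈ G', xOf (Point.some _ _ W.nonsingular_formalPoint + v) := by
    rw [← hTu]
    simp_rw [add_assoc]
    exact hG'odd.sum_comp_add_left (fun v => xOf (Point.some _ _ W.nonsingular_formalPoint + v)) hu'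
  rw [veluP₂_eq_veluD_sq hG'odd, Polynomial.eval_pow] at hx₁ hx₂
  rw [hNinv] at hN₂
  rw [hsumx] at hx₂
  -- read the polynomial `Q` over `F((z))`
  have hQmap : ∀ x : 𝓛, (Q.map (algebraMap F 𝓛)).eval x =
      (veluV G' a').eval x - algebraMap F 𝓛 ((veluD G).eval a ^ 2) * (veluU G').eval x -
        algebraMap F 𝓛 (veluMu G a) * (veluD G').eval x ^ 2 := by
    intro x
    rw [hQdef, Polynomial.map_sub, Polynomial.map_sub, Polynomial.map_mul, Polynomial.map_mul,
      Polynomial.map_pow, Polynomial.map_C, Polynomial.map_C, hG', veluV_image, veluU_image, veluD_image]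
    simp only [Polynomial.eval_sub, Polynomial.eval_mul, Polynomial.eval_C, Polynomial.eval_pow]
  have hDmap : ∀ x : 𝓛, ((veluD G).map (algebraMap F 𝓛)).eval x = (veluD G').eval x := by
    intro x; rw [hG', veluD_image]
  rw [hQmap, hQmap, hDmap, hDmap]
  set N := ∏ v ∈ G', (xOf (Point.some _ _ W.nonsingular_formalPoint + v) - a')
  set Sx := ∑ v ∈ G', xOf (Point.some _ _ W.nonsingular_formalPoint + v) - ∑ v ∈ G'.erase 0, xOf v
  set D₁ := (veluD G').eval (ιL W.formalXMulSq * (ιL PowerSeries.X)⁻¹ ^ 2)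
  set D₂ := (veluD G').eval (ιL Φ)
  set c := algebraMap F 𝓛 ((veluD G).eval a ^ 2)
  set μ := algebraMap F 𝓛 (veluMu G a)
  linear_combination -(D₂ ^ 2 * hN₁) + D₁ ^ 2 * hN₂ + c * (D₂ ^ 2 * hx₁ - D₁ ^ 2 * hx₂)

/-! ### The `2`-torsion trick: `μ_r = -U(r)`, the roots `ρ_r` of the Vélu cubic, `3U = Σ V_{rᵢ}/D(rᵢ)²` -/

variable {W}

omit [W.IsElliptic] in
/-- A root `r` of `f` is not the `x`-coordinate of a point of `G ∖ O` (the point `(r, 0)` is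
`2`-torsion). [folklore] -/
theorem xOf_ne_of_isRoot {G : Finset (W⁄F).toAffine.Point} (hG : IsOddSubgroupFinset G) {r : F}
    (hr : (veluF (W⁄F)).eval r = 0) : ∀ v ∈ G.erase 0, xOf v ≠ r := by
  intro v hv hx
  have hv0 : v ≠ 0 := (Finset.mem_erase.mp hv).1
  rcases v with _ | ⟨c, yc, hc⟩
  · exact hv0 rfl
  rw [xOf_some] at hx
  subst hx
  have hy : yc ^ 2 = 0 := by rw [yOf_sq_eq hc, ← eval_veluF, hr]
  have hy0 : yc = 0 := pow_eq_zero_iff two_ne_zero |>.mp hy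
  refine hv0 (hG.eq_zero_of_neg_eq _ (Finset.mem_erase.mp hv).2 ?_)
  rw [neg_some]; congr 1; rw [negY_of_isShortNF, hy0, _root_.neg_zero]

/-- `(r, 0)` is a (nonsingular) point when `f(r) = 0`. [folklore] -/
theorem nonsingular_of_isRoot {r : F} (hr : (veluF (W⁄F)).eval r = 0) : (W⁄F).toAffine.Nonsingular r 0 := by
  refine (Affine.equation_iff_nonsingular (W := (W⁄F).toAffine)).mp ?_
  rw [Affine.equation_iff, (W⁄F).a₁_of_isShortNF, (W⁄F).a₂_of_isShortNF, (W⁄F).a₃_of_isShortNF]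
  rw [eval_veluF] at hr
  linear_combination -hr

/-- `f'(r) = 3r² + a₄ ≠ 0` at a root `r` of `f` (the curve is smooth at `(r, 0)`). [folklore] -/
theorem three_mul_sq_add_ne_zero_of_isRoot {r : F} (hr : (veluF (W⁄F)).eval r = 0) :
    3 * r ^ 2 + (W⁄F).a₄ ≠ 0 := by
  have h := ((Affine.nonsingular_iff' _ _).mp (nonsingular_of_isRoot hr)).2
  rw [(W⁄F).a₁_of_isShortNF, (W⁄F).a₂_of_isShortNF, (W⁄F).a₃_of_isShortNF] at h
  rcases h with h | h
  · intro h0; apply h; linear_combination -h0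
  · exfalso; apply h; ring

omit [W.IsElliptic] in
/-- `-(r, 0) = (r, 0)`. [folklore] -/
theorem neg_some_zero_eq {r : F} (h : (W⁄F).toAffine.Nonsingular r 0) : -Point.some r 0 h = Point.some r 0 h := by
  rw [neg_some]; congr 1; rw [negY_of_isShortNF, _root_.neg_zero]

/-- **`μ_r = -U(r)`** for a root `r` of `f`: evaluate `V_r = D(r)²U + μ_rD²` at `X = r`, where
`V_r(r) = 0` and `D(r) ≠ 0`. [Blakestad–Grant 2023, proof of Prop. 7 (`x_p - rᵢ' = cᵢ²N(x - rᵢ)`)]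
[cite: BlakestadGrant2023, Prop. 7] -/
theorem veluMu_eq_of_isRoot [CharZero F] {G : Finset (W⁄F).toAffine.Point} (hG : IsOddSubgroupFinset G)
    {r : F} (hr : (veluF (W⁄F)).eval r = 0) : veluMu G r = -(veluU G).eval r := by
  have hD : (veluD G).eval r ≠ 0 := eval_veluD_ne_zero (xOf_ne_of_isRoot hG hr)
  have h := congrArg (Polynomial.eval r) (W.veluV_eq hG r)
  rw [eval_veluV, sub_self, zero_mul, Polynomial.eval_add, Polynomial.eval_mul, Polynomial.eval_mul,
    Polynomial.eval_C, Polynomial.eval_C, Polynomial.eval_pow] at h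
  have h2 : (veluD G).eval r ^ 2 * (veluMu G r + (veluU G).eval r) = 0 := by linear_combination -h
  rcases mul_eq_zero.mp h2 with h3 | h3
  · exact (pow_ne_zero 2 hD h3).elim
  · linear_combination h3

/-- `V_r = D(r)²·(U - ρ_r·D²)` for a root `r` of `f`. [Blakestad–Grant 2023, proof of Prop. 7]
[cite: BlakestadGrant2023, Prop. 7] -/
theorem veluV_eq_of_isRoot [CharZero F] {G : Finset (W⁄F).toAffine.Point} (hG : IsOddSubgroupFinset G)
    {r : F} (hr : (veluF (W⁄F)).eval r = 0) :
    veluV G r = Polynomial.C ((veluD G).eval r ^ 2) * (veluU G - Polynomial.C (veluRho G r) * veluD G ^ 2) := by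
  have hD : (veluD G).eval r ≠ 0 := eval_veluD_ne_zero (xOf_ne_of_isRoot hG hr)
  rw [W.veluV_eq hG r, veluMu_eq_of_isRoot hG hr, veluRho]
  have hC : Polynomial.C ((veluD G).eval r ^ 2) * Polynomial.C ((veluU G).eval r / (veluD G).eval r ^ 2) =
      Polynomial.C ((veluU G).eval r) := by
    rw [← Polynomial.C_mul, mul_div_cancel₀ _ (pow_ne_zero 2 hD)]
  rw [map_neg]
  linear_combination (veluD G ^ 2) * hC

/-- **`ρ_r` is a root of the Vélu cubic `X³ + a'X + b'`** (the image `ψ(r, 0) = (ρ_r, 0)` of the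
`2`-torsion point lies on `E'`). [Vélu 1971; Blakestad–Grant 2023, proof of Prop. 7 (the roots
`rᵢ'` of `f_p`)] [cite: BlakestadGrant2023, Prop. 7] -/
theorem veluRho_isRoot [CharZero F] {G : Finset (W⁄F).toAffine.Point} (hG : IsOddSubgroupFinset G)
    {r : F} (hr : (veluF (W⁄F)).eval r = 0) :
    veluRho G r ^ 3 + veluA G * veluRho G r + veluB G = 0 := by
  have h := (W.veluMap_mem hG (nonsingular_of_isRoot hr) (xOf_ne_of_isRoot hG hr)).1
  rw [veluP₂_eq_veluD_sq hG, Polynomial.eval_pow, zero_mul, zero_div, zero_pow two_ne_zero] at h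
  rw [veluRho]
  linear_combination -h

/-- **`U = ρ_r·D²` along the coset `(r, 0) + G`**: for a root `r` of `f` and `v ∈ G`, the point
`Q = (r, 0) + v` is affine, avoids `x(G ∖ O)`, and `U(x(Q)) = ρ_r·D(x(Q))²` (Vélu's `x₁ = U/D²`
is `G`-invariant and equals `ρ_r` at `(r, 0)`). [Vélu 1971 (invariance of `X`)] [folklore] -/
theorem eval_veluU_coset_eq [CharZero F] {G : Finset (W⁄F).toAffine.Point} (hG : IsOddSubgroupFinset G)
    {r : F} (hr : (veluF (W⁄F)).eval r = 0) {v : (W⁄F).toAffine.Point} (hv : v ∈ G) :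
    Point.some r 0 (nonsingular_of_isRoot hr) + v ≠ 0 ∧
    (veluU G).eval (xOf (Point.some r 0 (nonsingular_of_isRoot hr) + v)) =
      veluRho G r * (veluD G).eval (xOf (Point.some r 0 (nonsingular_of_isRoot hr) + v)) ^ 2 := by
  set P := Point.some r 0 (nonsingular_of_isRoot hr) with hP
  have hgoodr := xOf_ne_of_isRoot hG hr
  -- `P ∉ G`
  have hPG : P ∉ G := fun h => hgoodr P (Finset.mem_erase.mpr ⟨by rw [hP]; exact Point.some_ne_zero _, h⟩)
    (by rw [hP, xOf_some])
  have hQ0 : P + v ≠ 0 := by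
    intro h0
    have : P = -v := eq_neg_of_add_eq_zero_left h0
    exact hPG (this ▸ hG.neg_mem v hv)
  refine ⟨hQ0, ?_⟩
  obtain ⟨hQ, hQeq⟩ := exists_eq_some_xOf_yOf hQ0
  have hgoodQ : ∀ w ∈ G.erase 0, xOf w ≠ xOf (P + v) := by
    intro w hw hx
    have hw0 := (Finset.mem_erase.mp hw).1
    rcases eq_or_eq_neg_of_xOf_eq hw0 hQ0 hx with h | h
    · exact hPG (by
        have : P = w - v := by rw [h]; abel
        rw [this, sub_eq_add_neg]; exact hG.add_mem _ (Finset.mem_erase.mp hw).2 _ (hG.neg_mem v hv))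
    · exact hPG (by
        have : P = -w - v := by rw [h]; abel
        rw [this, sub_eq_add_neg]
        exact hG.add_mem _ (hG.neg_mem _ (Finset.mem_erase.mp hw).2) _ (hG.neg_mem v hv))
  have hxQ := veluP₂_mul_sum_xOf hG two_ne_zero hQ hgoodQ
  have hxP := veluP₂_mul_sum_xOf hG two_ne_zero (nonsingular_of_isRoot hr) hgoodr
  rw [← hQeq] at hxQ
  rw [← hP] at hxP
  have hsum : ∑ w ∈ G, xOf (P + v + w) = ∑ w ∈ G, xOf (P + w) := by
    simp_rw [add_assoc]
    exact hG.sum_comp_add_left (fun w => xOf (P + w)) hv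
  rw [hsum] at hxQ
  rw [veluP₂_eq_veluD_sq hG, Polynomial.eval_pow] at hxQ hxP
  have hD : (veluD G).eval r ≠ 0 := eval_veluD_ne_zero hgoodr
  have hρ : veluRho G r = ∑ w ∈ G, xOf (P + w) - ∑ w ∈ G.erase 0, xOf w := by
    rw [veluRho, div_eq_iff (pow_ne_zero 2 hD)]
    linear_combination -hxP
  rw [hρ]
  linear_combination -hxQ

/-- `(r, 0) ∉ G` for a root `r` of `f`. [folklore] -/
theorem some_zero_notMem_of_isRoot {G : Finset (W⁄F).toAffine.Point} (hG : IsOddSubgroupFinset G)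
    {r : F} (hr : (veluF (W⁄F)).eval r = 0) : Point.some r 0 (nonsingular_of_isRoot hr) ∉ G := fun h =>
  xOf_ne_of_isRoot hG hr _ (Finset.mem_erase.mpr ⟨Point.some_ne_zero _, h⟩) (xOf_some _)

omit [W.IsShortNF] [W.IsElliptic] in
/-- **Fibres of `v ↦ x(P + v)` on `G` have at most two elements** when `-P = P` and `P ∉ G`
(then `P + v ≠ O`, and `x(P + v) = x(P + v')` forces `v' = v` or `v' = -v - 2P = -v`). [folklore] -/
theorem card_filter_xOf_add_le_two {G : Finset (W⁄F).toAffine.Point} (hG : IsOddSubgroupFinset G)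
    {P : (W⁄F).toAffine.Point} (hPneg : -P = P) (hPG : P ∉ G) :
    ∀ b ∈ G.image (fun v => xOf (P + v)), (G.filter fun v => xOf (P + v) = b).card ≤ 2 := by
  intro b hb
  obtain ⟨v₀, hv₀, rfl⟩ := Finset.mem_image.mp hb
  have hne0 : ∀ v ∈ G, P + v ≠ 0 := fun v hv h0 => hPG (eq_neg_of_add_eq_zero_left h0 ▸ hG.neg_mem v hv)
  have hPP : P + P = 0 := by rw [show P + P = -P + P by rw [hPneg], neg_add_cancel]
  refine (Finset.card_le_card (t := {v₀, -v₀}) fun v hv => ?_).trans Finset.card_le_two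
  obtain ⟨hvG, hx⟩ := Finset.mem_filter.mp hv
  rcases eq_or_eq_neg_of_xOf_eq (hne0 v hvG) (hne0 v₀ hv₀) hx with h | h
  · rw [Finset.mem_insert]; exact Or.inl (add_left_cancel h)
  · rw [Finset.mem_insert, Finset.mem_singleton]; right
    have e : v = -(P + v₀) - P := by rw [← h]; abel
    have e2 : -(P + v₀) - P = -v₀ - (P + P) := by abel
    rw [e, e2, hPP, sub_zero]

/-- **Distinct roots of `f` give distinct `ρ`** (`ψ` is injective on `E[2]`): if `ρ_{r₁} = ρ_{r₂}`
then the degree-`p` polynomial `U - ρD²` vanishes at the `x`-coordinates of the two cosets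
`(rᵢ, 0) + G`, which are `≥ (n+1) + (n+1) = p + 1` distinct values. [Blakestad–Grant 2023, proof
of Prop. 7 (the three roots `rᵢ'` of `f_p`); Silverman AEC III.4.12] [folklore] -/
theorem veluRho_injective [CharZero F] {G : Finset (W⁄F).toAffine.Point} (hG : IsOddSubgroupFinset G)
    {r₁ r₂ : F} (hr₁ : (veluF (W⁄F)).eval r₁ = 0) (hr₂ : (veluF (W⁄F)).eval r₂ = 0) (hne : r₁ ≠ r₂) :
    veluRho G r₁ ≠ veluRho G r₂ := by
  intro hρ
  set n := (veluXVals G).card with hndef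
  set P₁ := Point.some r₁ 0 (nonsingular_of_isRoot hr₁) with hP₁
  set P₂ := Point.some r₂ 0 (nonsingular_of_isRoot hr₂) with hP₂
  have hP₁G : P₁ ∉ G := some_zero_notMem_of_isRoot hG hr₁
  have hP₂G : P₂ ∉ G := some_zero_notMem_of_isRoot hG hr₂
  have hP₁neg : -P₁ = P₁ := neg_some_zero_eq _
  have hP₂neg : -P₂ = P₂ := neg_some_zero_eq _
  set Pol := veluU G - Polynomial.C (veluRho G r₁) * veluD G ^ 2 with hPol
  have hU : (veluU G).natDegree = 2 * n + 1 := by rw [natDegree_veluU hG, card_erase_zero_eq hG]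
  have hD2 : (veluD G ^ 2).natDegree = 2 * n := by rw [Polynomial.natDegree_pow, natDegree_veluD, ← hndef]
  have htop : Pol.coeff (2 * n + 1) = 1 := by
    rw [hPol, Polynomial.coeff_sub, Polynomial.coeff_C_mul, ← hU, (monic_veluU hG).coeff_natDegree, hU,
      Polynomial.coeff_eq_zero_of_natDegree_lt (by rw [hD2]; omega), mul_zero, sub_zero]
  have hPol0 : Pol ≠ 0 := fun h => by rw [h, Polynomial.coeff_zero] at htop; exact zero_ne_one htop
  have hPoldeg : Pol.natDegree ≤ 2 * n + 1 := by
    rw [hPol]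
    refine (Polynomial.natDegree_sub_le _ _).trans (max_le hU.le ((Polynomial.natDegree_C_mul_le _ _).trans ?_))
    rw [hD2]; omega
  -- the roots: both cosets
  have hroot₁ : ∀ v ∈ G, Pol.eval (xOf (P₁ + v)) = 0 := by
    intro v hv
    obtain ⟨-, h⟩ := eval_veluU_coset_eq hG hr₁ hv
    rw [← hP₁] at h
    simp only [hPol, Polynomial.eval_sub, Polynomial.eval_mul, Polynomial.eval_C, Polynomial.eval_pow]
    linear_combination h
  have hroot₂ : ∀ v ∈ G, Pol.eval (xOf (P₂ + v)) = 0 := by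
    intro v hv
    obtain ⟨-, h⟩ := eval_veluU_coset_eq hG hr₂ hv
    rw [← hP₂] at h
    simp only [hPol, Polynomial.eval_sub, Polynomial.eval_mul, Polynomial.eval_C, Polynomial.eval_pow, hρ]
    linear_combination h
  -- each coset contributes `≥ n + 1` values
  have hGcard : G.card = 2 * n + 1 := by
    rw [← Finset.card_erase_add_one hG.zero_mem, card_erase_zero_eq hG, ← hndef]
  have hc₁ := Finset.card_le_mul_card_image G 2 (card_filter_xOf_add_le_two hG hP₁neg hP₁G)
  have hc₂ := Finset.card_le_mul_card_image G 2 (card_filter_xOf_add_le_two hG hP₂neg hP₂G)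
  rw [hGcard] at hc₁ hc₂
  set R₁ := G.image (fun v => xOf (P₁ + v)) with hR₁
  set R₂ := G.image (fun v => xOf (P₂ + v)) with hR₂
  -- `P₁ + P₂` is a nonzero `2`-torsion point, hence not in `G`; so the two cosets are `x`-disjoint
  have h12 : P₁ + P₂ ∉ G := by
    intro hmem
    have hneg : -(P₁ + P₂) = P₁ + P₂ := by rw [neg_add, hP₁neg, hP₂neg, add_comm]
    have h0 := hG.eq_zero_of_neg_eq _ hmem hneg
    have : P₁ = -P₂ := eq_neg_of_add_eq_zero_left h0
    rw [hP₂neg, hP₁, hP₂] at this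
    exact hne (by have := congrArg xOf this; rwa [xOf_some, xOf_some] at this)
  have hdisj : Disjoint R₁ R₂ := by
    rw [Finset.disjoint_left]
    intro a ha₁ ha₂
    obtain ⟨v, hv, rfl⟩ := Finset.mem_image.mp ha₁
    obtain ⟨v', hv', hvv'⟩ := Finset.mem_image.mp ha₂
    have hQ₁ := (eval_veluU_coset_eq hG hr₁ hv).1
    have hQ₂ := (eval_veluU_coset_eq hG hr₂ hv').1
    rw [← hP₁] at hQ₁; rw [← hP₂] at hQ₂
    rcases eq_or_eq_neg_of_xOf_eq hQ₂ hQ₁ hvv' with h | h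
    · apply h12
      have e : P₁ + P₂ = v' - v + (P₂ + P₂) := by
        have e' : P₁ = P₂ + v' - v := by rw [h]; abel
        rw [e']; abel
      have hPP : P₂ + P₂ = 0 := by rw [show P₂ + P₂ = -P₂ + P₂ by rw [hP₂neg], neg_add_cancel]
      rw [e, hPP, add_zero, sub_eq_add_neg]
      exact hG.add_mem _ hv' _ (hG.neg_mem _ hv)
    · apply h12
      have e : P₁ + P₂ = -(v + v') := by
        have e' : P₁ = -(P₂ + v') - v := by rw [h]; abel
        rw [e']; abel
      rw [e]
      exact hG.neg_mem _ (hG.add_mem _ hv _ hv')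
  have hRcard : (R₁ ∪ R₂).card = R₁.card + R₂.card := Finset.card_union_of_disjoint hdisj
  -- `Π_{a ∈ R₁ ∪ R₂} (X - a) ∣ Pol`
  have hdvd : ∏ a ∈ R₁ ∪ R₂, (Polynomial.X - Polynomial.C a) ∣ Pol := by
    refine Finset.prod_dvd_of_coprime
      (fun a _ b _ hab => Polynomial.isCoprime_X_sub_C_of_isUnit_sub (sub_ne_zero.mpr hab).isUnit) ?_
    intro a ha
    rw [Polynomial.dvd_iff_isRoot, Polynomial.IsRoot.def]
    rcases Finset.mem_union.mp ha with ha | ha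
    · obtain ⟨v, hv, rfl⟩ := Finset.mem_image.mp ha; exact hroot₁ v hv
    · obtain ⟨v, hv, rfl⟩ := Finset.mem_image.mp ha; exact hroot₂ v hv
  have hdeg₁ : (∏ a ∈ R₁ ∪ R₂, (Polynomial.X - Polynomial.C a)).natDegree = (R₁ ∪ R₂).card := by
    rw [Polynomial.natDegree_prod_of_monic _ _ fun a _ => Polynomial.monic_X_sub_C a]
    simp
  have hle := Polynomial.natDegree_le_of_dvd hdvd hPol0
  rw [hdeg₁, hRcard] at hle
  omega

omit [W.IsElliptic] in
omit [W.IsShortNF] in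
/-- For `f = (X - r₁)(X - r₂)(X - r₃)`: `rᵢ` is a root of `f`. [folklore] -/
theorem isRoot_of_factorisation {r₁ r₂ r₃ : F}
    (hf : veluF (W⁄F) = (Polynomial.X - Polynomial.C r₁) * (Polynomial.X - Polynomial.C r₂) *
      (Polynomial.X - Polynomial.C r₃)) :
    (veluF (W⁄F)).eval r₁ = 0 ∧ (veluF (W⁄F)).eval r₂ = 0 ∧ (veluF (W⁄F)).eval r₃ = 0 := by
  refine ⟨?_, ?_, ?_⟩ <;> simp [hf]

/-- For `f = (X - r₁)(X - r₂)(X - r₃)`: `(r₁ - r₂)(r₁ - r₃) = f'(r₁) = 3r₁² + a₄ ≠ 0`, so the roots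
are distinct (the curve is nonsingular). [Silverman AEC III.1 (`Δ ≠ 0` iff `f` has distinct
roots)] [folklore] -/
theorem roots_distinct_of_factorisation {r₁ r₂ r₃ : F}
    (hf : veluF (W⁄F) = (Polynomial.X - Polynomial.C r₁) * (Polynomial.X - Polynomial.C r₂) *
      (Polynomial.X - Polynomial.C r₃)) :
    r₁ ≠ r₂ ∧ r₁ ≠ r₃ ∧ r₂ ≠ r₃ := by
  -- `f'(r) = (r - r')(r - r'')` for each root, by differentiating the factorisation
  have key : ∀ {a b c : F}, veluF (W⁄F) = (Polynomial.X - Polynomial.C a) * (Polynomial.X - Polynomial.C b) *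
      (Polynomial.X - Polynomial.C c) → (a - b) * (a - c) = 3 * a ^ 2 + (W⁄F).a₄ := by
    intro a b c h
    have hd := congrArg (fun q => (Polynomial.derivative q).eval a) h
    simp only [veluF, Polynomial.derivative_add, Polynomial.derivative_mul, Polynomial.derivative_X_pow,
      Polynomial.derivative_X, Polynomial.derivative_C, map_sub, Polynomial.eval_add, Polynomial.eval_mul,
      Polynomial.eval_sub, Polynomial.eval_pow, Polynomial.eval_X, Polynomial.eval_C, Polynomial.eval_one,
      mul_one, zero_mul, add_zero, zero_add, sub_zero, sub_self] at hd
    norm_num at hd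
    have e4 : (W⁄F).a₄ = W.a₄ := rfl
    rw [e4]
    linear_combination -hd
  obtain ⟨hr₁, hr₂, hr₃⟩ := isRoot_of_factorisation hf
  have h₁ := key hf
  have h₂ : (r₂ - r₁) * (r₂ - r₃) = 3 * r₂ ^ 2 + (W⁄F).a₄ := key (by rw [hf]; ring)
  have n₁ := three_mul_sq_add_ne_zero_of_isRoot hr₁
  have n₂ := three_mul_sq_add_ne_zero_of_isRoot hr₂
  rw [← h₁] at n₁
  rw [← h₂] at n₂
  refine ⟨fun h => n₁ ?_, fun h => n₁ ?_, fun h => n₂ ?_⟩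
  · rw [h, sub_self, zero_mul]
  · rw [h, sub_self, mul_zero]
  · rw [h, sub_self, mul_zero]

/-- `(X - a)(X - b)(X - c) = X³ - (a+b+c)X² + (ab+ac+bc)X - abc`. [folklore] -/
theorem X_sub_C_mul_three (a b c : F) :
    (Polynomial.X - Polynomial.C a) * (Polynomial.X - Polynomial.C b) * (Polynomial.X - Polynomial.C c) =
      Polynomial.X ^ 3 - Polynomial.C (a + b + c) * Polynomial.X ^ 2 +
        Polynomial.C (a * b + a * c + b * c) * Polynomial.X - Polynomial.C (a * b * c) := by
  simp only [map_add, map_mul]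
  ring

/-- **The Vélu cubic splits over the `ρ`'s**: for `f = (X - r₁)(X - r₂)(X - r₃)`,
`X³ + a'X + b' = (X - ρ₁)(X - ρ₂)(X - ρ₃)` with `ρᵢ = ρ_{rᵢ}` (three distinct roots of a monic
cubic). [Blakestad–Grant 2023, proof of Prop. 7 ("let `rᵢ, rᵢ'` be respectively roots of `f` and
`f_p'`")] [cite: BlakestadGrant2023, Prop. 7] -/
theorem veluCubic_eq_prod [CharZero F] {G : Finset (W⁄F).toAffine.Point} (hG : IsOddSubgroupFinset G)
    {r₁ r₂ r₃ : F} (hf : veluF (W⁄F) = (Polynomial.X - Polynomial.C r₁) * (Polynomial.X - Polynomial.C r₂) *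
      (Polynomial.X - Polynomial.C r₃)) :
    Polynomial.X ^ 3 + Polynomial.C (veluA G) * Polynomial.X + Polynomial.C (veluB G) =
      (Polynomial.X - Polynomial.C (veluRho G r₁)) * (Polynomial.X - Polynomial.C (veluRho G r₂)) *
        (Polynomial.X - Polynomial.C (veluRho G r₃)) := by
  obtain ⟨hr₁, hr₂, hr₃⟩ := isRoot_of_factorisation hf
  obtain ⟨h12, h13, h23⟩ := roots_distinct_of_factorisation hf
  have hρ12 := veluRho_injective hG hr₁ hr₂ h12
  have hρ13 := veluRho_injective hG hr₁ hr₃ h13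
  have hρ23 := veluRho_injective hG hr₂ hr₃ h23
  set g := Polynomial.X ^ 3 + Polynomial.C (veluA G) * Polynomial.X + Polynomial.C (veluB G) with hg
  have hlin : (Polynomial.C (veluA G) * Polynomial.X + Polynomial.C (veluB G)).degree < ((3 : ℕ) : WithBot ℕ) :=
    Polynomial.degree_linear_le.trans_lt (by decide)
  have hgmonic : g.Monic := by
    rw [hg, add_assoc]; exact Polynomial.monic_X_pow_add hlin
  have hgdeg : g.natDegree = 3 := by
    rw [hg, add_assoc, Polynomial.natDegree_add_eq_left_of_degree_lt, Polynomial.natDegree_X_pow]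
    rw [Polynomial.degree_X_pow]; exact hlin
  have hgroot : ∀ r, (veluF (W⁄F)).eval r = 0 → g.eval (veluRho G r) = 0 := fun r hr => by
    rw [hg]
    simp only [Polynomial.eval_add, Polynomial.eval_mul, Polynomial.eval_pow, Polynomial.eval_X, Polynomial.eval_C]
    linear_combination veluRho_isRoot hG hr
  set ρ₁ := veluRho G r₁
  set ρ₂ := veluRho G r₂
  set ρ₃ := veluRho G r₃
  have hdvd : ∏ a ∈ ({ρ₁, ρ₂, ρ₃} : Finset F), (Polynomial.X - Polynomial.C a) ∣ g := by
    refine Finset.prod_dvd_of_coprime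
      (fun a _ b _ hab => Polynomial.isCoprime_X_sub_C_of_isUnit_sub (sub_ne_zero.mpr hab).isUnit) ?_
    intro a ha
    rw [Polynomial.dvd_iff_isRoot, Polynomial.IsRoot.def]
    simp only [Finset.mem_insert, Finset.mem_singleton] at ha
    rcases ha with rfl | rfl | rfl
    · exact hgroot r₁ hr₁
    · exact hgroot r₂ hr₂
    · exact hgroot r₃ hr₃
  have hprod : ∏ a ∈ ({ρ₁, ρ₂, ρ₃} : Finset F), (Polynomial.X - Polynomial.C a) =
      (Polynomial.X - Polynomial.C ρ₁) * (Polynomial.X - Polynomial.C ρ₂) * (Polynomial.X - Polynomial.C ρ₃) := by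
    rw [Finset.prod_insert (by simp [hρ12, hρ13]), Finset.prod_insert (by simp [hρ23]), Finset.prod_singleton]
    ring
  rw [hprod] at hdvd
  have hpmonic : ((Polynomial.X - Polynomial.C ρ₁) * (Polynomial.X - Polynomial.C ρ₂) *
      (Polynomial.X - Polynomial.C ρ₃)).Monic :=
    ((Polynomial.monic_X_sub_C _).mul (Polynomial.monic_X_sub_C _)).mul (Polynomial.monic_X_sub_C _)
  have hpdeg : ((Polynomial.X - Polynomial.C ρ₁) * (Polynomial.X - Polynomial.C ρ₂) *
      (Polynomial.X - Polynomial.C ρ₃)).natDegree = 3 := by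
    rw [Polynomial.natDegree_mul (mul_ne_zero (Polynomial.X_sub_C_ne_zero _) (Polynomial.X_sub_C_ne_zero _))
      (Polynomial.X_sub_C_ne_zero _), Polynomial.natDegree_mul (Polynomial.X_sub_C_ne_zero _)
      (Polynomial.X_sub_C_ne_zero _)]
    simp
  exact Polynomial.eq_of_monic_of_dvd_of_natDegree_le hpmonic hgmonic hdvd (by rw [hgdeg, hpdeg])

/-- **Vieta for the `ρ`'s**: `ρ₁ + ρ₂ + ρ₃ = 0`, `ρ₁ρ₂ + ρ₁ρ₃ + ρ₂ρ₃ = a'`, `ρ₁ρ₂ρ₃ = -b'`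
(`f_p'` is in short form). [Blakestad–Grant 2023, proof of Prop. 7 (`x_p = ⅓Σ(x_p - rᵢ')`)]
[folklore] -/
theorem veluRho_vieta [CharZero F] {G : Finset (W⁄F).toAffine.Point} (hG : IsOddSubgroupFinset G)
    {r₁ r₂ r₃ : F} (hf : veluF (W⁄F) = (Polynomial.X - Polynomial.C r₁) * (Polynomial.X - Polynomial.C r₂) *
      (Polynomial.X - Polynomial.C r₃)) :
    veluRho G r₁ + veluRho G r₂ + veluRho G r₃ = 0 ∧
    veluRho G r₁ * veluRho G r₂ + veluRho G r₁ * veluRho G r₃ + veluRho G r₂ * veluRho G r₃ = veluA G ∧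
    veluRho G r₁ * veluRho G r₂ * veluRho G r₃ = -veluB G := by
  have h := veluCubic_eq_prod hG hf
  rw [X_sub_C_mul_three] at h
  have h2 := congrArg (Polynomial.coeff · 2) h
  have h1 := congrArg (Polynomial.coeff · 1) h
  have h0 := congrArg (Polynomial.coeff · 0) h
  simp only [Polynomial.coeff_add, Polynomial.coeff_sub, Polynomial.coeff_C_mul, Polynomial.coeff_X_pow,
    Polynomial.coeff_X, Polynomial.coeff_C] at h2 h1 h0
  norm_num at h2 h1 h0
  exact ⟨by linear_combination h2, by linear_combination -h1, by linear_combination h0⟩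

/-- **`3U = Σᵢ V_{rᵢ}/D(rᵢ)²`** — Blakestad–Grant's `x_p = ⅓ Σᵢ cᵢ² N(x - rᵢ)`
(`cᵢ² = 1/(p²N'(x - rᵢ)) = 1/φ_ψ(rᵢ)²`), in polynomial form (`V_{rᵢ}/D(rᵢ)² = U - ρᵢD²` and
`Σρᵢ = 0`). [Blakestad–Grant 2023, proof of Prop. 7] [cite: BlakestadGrant2023, Prop. 7] -/
theorem three_mul_veluU_eq [CharZero F] {G : Finset (W⁄F).toAffine.Point} (hG : IsOddSubgroupFinset G)
    {r₁ r₂ r₃ : F} (hf : veluF (W⁄F) = (Polynomial.X - Polynomial.C r₁) * (Polynomial.X - Polynomial.C r₂) *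
      (Polynomial.X - Polynomial.C r₃)) :
    Polynomial.C ((veluD G).eval r₁ ^ 2)⁻¹ * veluV G r₁ + Polynomial.C ((veluD G).eval r₂ ^ 2)⁻¹ * veluV G r₂ +
        Polynomial.C ((veluD G).eval r₃ ^ 2)⁻¹ * veluV G r₃ = 3 * veluU G := by
  obtain ⟨hr₁, hr₂, hr₃⟩ := isRoot_of_factorisation hf
  have key : ∀ r, (veluF (W⁄F)).eval r = 0 → Polynomial.C ((veluD G).eval r ^ 2)⁻¹ * veluV G r =
      veluU G - Polynomial.C (veluRho G r) * veluD G ^ 2 := by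
    intro r hr
    have hD : (veluD G).eval r ≠ 0 := eval_veluD_ne_zero (xOf_ne_of_isRoot hG hr)
    rw [veluV_eq_of_isRoot hG hr, ← mul_assoc, ← Polynomial.C_mul, inv_mul_cancel₀ (pow_ne_zero 2 hD),
      Polynomial.C_1, one_mul]
  have hs := congrArg Polynomial.C (veluRho_vieta hG hf).1
  rw [map_add, map_add, Polynomial.C_0] at hs
  rw [key r₁ hr₁, key r₂ hr₂, key r₃ hr₃]
  linear_combination (-(veluD G ^ 2)) * hs

/-- `Πᵢ (U - ρᵢD²) = U³ + a'UD⁴ + b'D⁶` (Vieta). [folklore] -/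
theorem prod_veluU_sub_eq [CharZero F] {G : Finset (W⁄F).toAffine.Point} (hG : IsOddSubgroupFinset G)
    {r₁ r₂ r₃ : F} (hf : veluF (W⁄F) = (Polynomial.X - Polynomial.C r₁) * (Polynomial.X - Polynomial.C r₂) *
      (Polynomial.X - Polynomial.C r₃)) :
    (veluU G - Polynomial.C (veluRho G r₁) * veluD G ^ 2) * (veluU G - Polynomial.C (veluRho G r₂) * veluD G ^ 2) *
        (veluU G - Polynomial.C (veluRho G r₃) * veluD G ^ 2) =
      veluU G ^ 3 + Polynomial.C (veluA G) * veluU G * veluD G ^ 4 + Polynomial.C (veluB G) * veluD G ^ 6 := by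
  obtain ⟨h1, h2, h3⟩ := veluRho_vieta hG hf
  have hs₁ := congrArg Polynomial.C h1
  have hs₂ := congrArg Polynomial.C h2
  have hs₃ := congrArg Polynomial.C h3
  simp only [map_add, map_mul, map_neg, Polynomial.C_0] at hs₁ hs₂ hs₃
  linear_combination (-(veluU G ^ 2 * veluD G ^ 2)) * hs₁ + (veluU G * veluD G ^ 4) * hs₂ - veluD G ^ 6 * hs₃

/-- **The quotient equation in kernel-polynomial form**: `f·M_D² = U³ + a'UD⁴ + b'D⁶`, i.e.
`(x, y) ↦ (U/D², yM_D/D³)` maps `y² = f(x)` to `y² = x³ + a'x + b'` (Vélu's identity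
`fS² = P₂(U³ + a'UP₂² + b'P₂³)` with `S = DM_D`, `P₂ = D²`). [Vélu 1971; Kohel 1996, §2.4;
Blakestad–Grant 2023, (3) and `y_p = yM(x)/φ_ψ(x)³`] [cite: Velu1971] -/
theorem veluF_mul_veluMD_sq [CharZero F] {G : Finset (W⁄F).toAffine.Point} (hG : IsOddSubgroupFinset G) :
    veluF (W⁄F) * veluMD G ^ 2 =
      veluU G ^ 3 + Polynomial.C (veluA G) * veluU G * veluD G ^ 4 + Polynomial.C (veluB G) * veluD G ^ 6 := by
  have h := veluF_mul_veluS_sq hG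
  rw [veluS_eq_veluD_mul hG, veluP₂_eq_veluD_sq hG] at h
  apply mul_left_cancel₀ (pow_ne_zero 2 (veluD_ne_zero G))
  linear_combination h

/-- **`f·M_D² = Πᵢ V_{rᵢ}/D(rᵢ)²`** — Blakestad–Grant's `y_p² = Πᵢ cᵢ²N(x - rᵢ) =
Πᵢ Sᵢ(x)/(φ_ψ(rᵢ)²φ_ψ(x)²)`, cleared of `φ_ψ(x)⁶ = p⁶D⁶`. [Blakestad–Grant 2023, proof of
Prop. 7] [cite: BlakestadGrant2023, Prop. 7] -/
theorem veluF_mul_veluMD_sq_eq_prod [CharZero F] {G : Finset (W⁄F).toAffine.Point} (hG : IsOddSubgroupFinset G)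
    {r₁ r₂ r₃ : F} (hf : veluF (W⁄F) = (Polynomial.X - Polynomial.C r₁) * (Polynomial.X - Polynomial.C r₂) *
      (Polynomial.X - Polynomial.C r₃)) :
    veluF (W⁄F) * veluMD G ^ 2 =
      (Polynomial.C ((veluD G).eval r₁ ^ 2)⁻¹ * veluV G r₁) * (Polynomial.C ((veluD G).eval r₂ ^ 2)⁻¹ * veluV G r₂) *
        (Polynomial.C ((veluD G).eval r₃ ^ 2)⁻¹ * veluV G r₃) := by
  obtain ⟨hr₁, hr₂, hr₃⟩ := isRoot_of_factorisation hf
  have key : ∀ r, (veluF (W⁄F)).eval r = 0 → Polynomial.C ((veluD G).eval r ^ 2)⁻¹ * veluV G r =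
      veluU G - Polynomial.C (veluRho G r) * veluD G ^ 2 := by
    intro r hr
    have hD : (veluD G).eval r ≠ 0 := eval_veluD_ne_zero (xOf_ne_of_isRoot hG hr)
    rw [veluV_eq_of_isRoot hG hr, ← mul_assoc, ← Polynomial.C_mul, inv_mul_cancel₀ (pow_ne_zero 2 hD),
      Polynomial.C_1, one_mul]
  rw [key r₁ hr₁, key r₂ hr₂, key r₃ hr₃, prod_veluU_sub_eq hG hf, veluF_mul_veluMD_sq hG]

end LaurentPoint

end WeierstrassCurve
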